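import Literature.MathematicalPhysics.QuantumFieldTheory.Balaban1983to89.B9SupplySockB9P3ZdSocketBoundaryMode

/-!
# `Balaban1983to89.B9SupplySockB9P3ZdBeta` — [Balaban1985RegularSpaces] (1.56)–(1.59) p. 86, (1.31) p. 82, p. 77 / [Balaban1985BackgroundPropagators]
# (3.16) p. 393, Thm 3.3 p. 399: EDITION β OF THE J-N06→N05 JUNCTION AT FINITE `Ω₀` — the level-0 CROSSING BONDS of `Ω₀` (one end-point in `Ω₀`)
# are carried by the averaging datum `|B₁|` as print's «b ∈ Λ₀» are (Q₀ = 1 there): the four-line collar socket `SockB9P3D4β`, the binder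
# `AvgAtβ`, the member supplier from [4] Theorem 3.3 re-proved VERBATIM, its family forms, and an A6 SATISFIABILITY WITNESS
# of the member supplier's hypothesis set at (cube member, truncation 0)

statement-level skeleton of published theorems with citation tags; proofs where landed; nothing here is a claim about the
Yang–Mills mass gap

PDF held: `paper:balaban1985-cmp99-regular-spaces-gauge-fixing` (B8; journal page = PDF page + 74): p. 77 («we denote by Ω also the set of bonds … at
least one end-point of b belongs to Ω»), p. 82 (1.31) («(1∕i) log Ū₁ʲ = B on Λ_j, j = 0, 1, …, k»), p. 86 (1.56)–(1.59), p. 88 (1.68);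
`paper:balaban1985-cmp99-background-propagators` ([4]; journal page = PDF page + 388): p. 393 (3.16) «⟨A, Q*aQA⟩ = Σ_{j=0}^{k} a Σ_{b∈Λ_j} (Lʲη)^{d−2}
|(Q_j(U)A)(b)|²», «Λ_j = Ω_j^{(j)} ∖ Ω_{j+1}^{(j)}», p. 399 Thm 3.3.  Print reading of record: lit-balaban-r06 Q-OWN-1 + desk CONCORD (2026-08-27): the only
printed site→bond rule is the star («at least one end-point»), so (3.16)'s `j = 0` constraint set and B8's «B on Λ₀» INCLUDE the crossing bonds.

CITATION HEADER (lean-in-tree rule).  Cell `pub-ymgap` (HUMAN RULING D-0062, Track A), DAG node N06 [B9] → N05 [B8] junction lineage, seat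
`pub-ymgap-dag-n06-b` (g10), 2026-08-27; the REPAIR companion of the two located certificates `B9SupplySockB9P3ZdAtBoundaryMode` (p537196: the five
member-local binders are jointly unsatisfiable at the cube members) and `B9SupplySockB9P3ZdSocketBoundaryMode` (the collar socket `SockB9P3D4` itself is
false there) — both by the boundary pure-gauge mode `d(𝟙_{Ω₀}·c)`, which the typed `|B₁|` (over `Λb`, whose level-0 bonds have BOTH end-points in `Ω₀` by
the law `ZdIdx.hbox`) and the collar `Φ₀` (over the sides that are NOT bonds of `Ω₀`) both miss.  A NEW file; nothing landed is modified (the landed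
`SockB9P3D4`, `AvgAt` and their suppliers stay as they are; this is an EDITION with new names); count-neutral.

WHAT IS DECLARED ∕ PROVED (kernel, 0 sorry).
* §1 `CrossB Ω₀ b` — the CROSSING (boundary) bonds of `Ω₀`: a bond of `Ω₀` (p. 77) not having both end-points in `Ω₀`; `crossB_bondTouches`,
  `crossB_of_mem_notMem`, `crossB_univ_false` (none at `Ω₀ = ℤᵈ`: the univ road's currency is unchanged).  ★ `SockB9P3D4β L B₀ B_∂ cP η k Ω Λs Λb` — the
  four-line collar socket of `B9SupplySockB9P3ZdLettersOmega.SockB9P3D4` VERBATIM except that the averaging datum reads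
  `|B₁|β = wsup 1 (LʲηQ_j(U₀)(iηA′) over {(j, c) : j ≤ k, c ∈ Λb k j} ∪ {(0, c) : c ∈ CrossB (Ω 0)})` — the level-0 identity averaging on the crossing
  bonds added (print's «B on Λ₀»); `sockB9P3D4β_anti`.
* §2 ★ `AvgAtβ` — the (3.16)∕(1.56) binder `B9SupplySockB9P3ZdAt.AvgAt` with the same `|B₁|β` on the right («(Lʲη)³|(Q*aQA)(b)| ≤ q|B₁|β»: print's Q*aQ
  has the mass `a` on every Λ₀-bond, crossing ones included); `wsupB1β_restrictDom` (`|B₁|β(𝟙_{Ω₀}A) = |B₁|β(A)`: the crossing bonds touch `Ω₀`).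
* §3 ★★ `sockB9P3D4β_at` — THE MEMBER SUPPLIER RE-PROVED VERBATIM: `DictAt` + `Prop6At` + `InvAt` + `CurvAt` + `LandauAt` + `AvgAtβ` + Theorem 3.3's
  (3.42)∕(3.46)∕(3.47) block at `(M, i, m)` + `Margin2` ⇒ `SockB9P3D4β` at the SAME constants (B₀′ = max{1, 2B₀max{1,q}}, B_∂ = (20d+2)B₀′,
  cP = min{1∕16, c₆∕M, a₀∕(K₆M), a₃∕(K₆M), 1∕(2B₀c₆₉K₆M+1)}); the proof is `B9SupplySockB9P3ZdAt.sockB9P3D4_at'` with `|B₁| ↦ |B₁|β` (two tokens);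
  ★ `sockB9P3D4β_allLevels_of_thm33_on` (from `B9.Thm33Printed` over any index map `ι` with `Margin2`), ★ `sockB9P3D4β_allLevels_explicit_on` (named constants).
* §4 ★★ A6 WITNESS (director-ym №189 (3)): `Witness.binders_inhabited_cube_zero` — at every cube member of (1.131) (`ρ ≥ 2`, `d ≥ 2`, `L ≥ 1`)
  and truncation `m = 0` the FULL hypothesis set of `sockB9P3D4β_at` (`DictAt`, `Prop6At`, `InvAt`, `CurvAt`, `LandauAt`, `AvgAtβ`, `Margin2`, Theorem
  3.3's (3.42)∕(3.46)∕(3.47) block) is INHABITED, for every C⋆-algebra `𝔸₀ : Type`: the TRIVIAL MASSIVE REGIME — letters `Δ′ := 0`, `DRD* := 0`,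
  `Q*aQ := a·1` with `a = 32dη⁻²`, and `G(U₀) := ext ∘ (𝟙(D*_{U₀}D_{U₀} + a)𝟙)⁻¹ ∘ restr` on the finite space of Ω₀-bond fields, built for EVERY unitary
  `U₀` as the fixed point of the contraction `v ↦ a⁻¹(J − D*_{U₀}D_{U₀}v)` (Lipschitz ½ by `B9SupplySockB9P3Zd.norm_Jcur_le_of_grad`), a one-member frame
  with `Reg335 := ⊤`, local entries `0` and (3.47)@−3 entries = the dictionary readings, proved with `B₀ = 1` (`Witness.glob_bounds`); ★
  `Witness.sockB9P3D4β_at_nonvacuous_cube_zero`: hence `SockB9P3D4β` HOLDS at that member and level for some `B₀, B_∂, cP > 0`.  Honest label: NOT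
  [4]'s operators; levels `m ≥ 1` are NOT witnessed (their inhabitation = [4] Sect. A + Thm 3.11, object-bound) — the family forms are A6-witnessed at
  `m = 0` only.

HONEST SCOPE.  (i) LETTERS, NOT OBJECTS in §§1–4 (`OpsZd` a parameter); §4's objects are the trivial massive regime, labelled so.  (ii) CONSUMER SIDE: a
knit taking a `SockB9P3D4β` family carries `|B₁|β ≥ |B₁|` on its right-hand sides (the crossing-bond values of `A′` = print's pinned `∂Ω₀` data, bounded
from (1.133)-type smallness like the collar term).  (iii) The DEAD-layer currency (`E(Ω₀)` := inner bonds) is not typed here.  (iv) Count-neutral; N05∕N06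
NOT discharged; nothing continuum ∕ ℝ⁴ ∕ OS ∕ mass-gap ∕ Clay.
-/

noncomputable section

open NormedSpace

namespace Literature.MathematicalPhysics.QuantumFieldTheory.Balaban1983to89.B9SupplySockB9P3ZdBeta

open B7Prop1Explicit (e U1)
open B7Prop1Local (InBox loK bondHiK)
open B7Prop2Explicit (unitaryUnits unitaryUnits_le_U1)
open B7Prop4GeneralLevels (linCovIter)
open B7Eq78Linearization (conjR)
open B8Ineq132 (covDerivFwd covDeriv InAk BondTouches)
open B8Eq140Level (SideTouches)
open B8Eq146AExpansion (iEta plaqCovDeriv)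
open B8Eq143PlaqExpansion (pdiv)
open B8Eq155JBound (Jcur wsup)
open B8ScaledSupNorm (bondNorm msup weight Bdd)
open B8Eq138LandauZd (IsLandau138 IsLandau138W QT covDivB logCfg covLap)
open B8Eq184Proof (cfgExp)
open B8Lemma1NonAbelian (mulCfg)
open B8LeafModelZd (ZdIdx)
open B9SupplySockB9P3ZdLetters (OpsZd deltaAOf)
open B9SupplySockB9P3ZdLettersOmega (OnDom restrictDom outerPart Margin2 restrictDom_of)
open B9SupplySockB9P3ZdOmega (collar_arith)
open B9SupplySockB9P3ZdAt (DictAt Prop6At InvAt CurvAt LandauAt)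

export B7Prop1Explicit (Site)

variable {d : ℕ}

/-! ## §1 The crossing bonds of `Ω₀` and the enlarged averaging datum `|B₁|β` -/

/-- **The CROSSING (boundary) bonds of `Ω₀`**: bonds of `Ω₀` in the p. 77 sense (an end-point in `Ω₀`) that do not have both end-points in
`Ω₀` — exactly the layer between the typed `|B₁|` (inner bonds) and the collar `Φ₀` (non-bonds of `Ω₀`). [cite: Balaban1985RegularSpaces, p.77 (convention before (1.5))] -/
def CrossB (Ω₀ : Set (Site d)) (b : Site d × Fin d) : Prop :=
  BondTouches Ω₀ b.1 b.2 ∧ ¬ (b.1 ∈ Ω₀ ∧ b.1 + e b.2 ∈ Ω₀)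

/-- A crossing bond is a bond of `Ω₀`. [cite: Balaban1985RegularSpaces, p.77 (convention before (1.5))] -/
theorem crossB_bondTouches {Ω₀ : Set (Site d)} {b : Site d × Fin d} (h : CrossB Ω₀ b) : BondTouches Ω₀ b.1 b.2 := h.1

/-- `⟨x, x + e_μ⟩` with `x ∈ Ω₀ ∌ x + e_μ` is a crossing bond. [cite: Balaban1985RegularSpaces, p.77 (convention before (1.5))] -/
theorem crossB_of_mem_notMem {Ω₀ : Set (Site d)} {x : Site d} {μ : Fin d} (hx : x ∈ Ω₀) (hx' : x + e μ ∉ Ω₀) :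
    CrossB Ω₀ (x, μ) := ⟨Or.inl hx, fun h => hx' h.2⟩

/-- `Ω₀ = ℤᵈ` (print's `Ω₀ = T`) has no crossing bonds — the univ road's currency is unchanged by edition β. [cite: Balaban1985RegularSpaces, p.77 («Ω_j = T_η»)] -/
theorem crossB_univ_false (b : Site d × Fin d) : ¬ CrossB (Set.univ : Set (Site d)) b :=
  fun h => h.2 ⟨Set.mem_univ _, Set.mem_univ _⟩

variable {𝔸 : Type*} [CStarAlgebra 𝔸]

section Socket

open B8Eq138LandauZd (IsLandau138W)

/-- ★ **THE FOUR-LINE COLLAR SOCKET, EDITION β** — `B9SupplySockB9P3ZdLettersOmega.SockB9P3D4` VERBATIM (datum, guards, the four conclusions, the collar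
term `B_∂Φ₀`) except that the averaging datum is `|B₁|β`: the `wsup` runs over the constraint bonds `Λb k j` AND the level-0 crossing bonds of `Ω₀`
(«(1∕i) log Ū₁ʲ = B on Λ_j, j = 0, …, k», (1.31); Q₀ = 1; the p. 77 bond convention). [cite: Balaban1985RegularSpaces, (1.57)–(1.59) p.86, (1.31) p.82, (1.40)–(1.42) p.83, p.77; Balaban1985BackgroundPropagators, Thm 3.3 p.399, (3.16) p.393] -/
def SockB9P3D4β (L : ℕ) (B₀ Bbd cP : ℝ) (η : ℝ) (k : ℕ) (Ω : ℕ → Set (Site d)) (Λs : ℕ → ℕ → Set (Site d))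
    (Λb : ℕ → ℕ → Set (Site d × Fin d)) : Prop :=
  ∀ α₀ α₂ : ℝ, 0 < α₀ → α₀ ≤ cP → 0 < α₂ → α₂ ≤ cP →
    ∀ (U₀ W : Site d → Fin d → 𝔸ˣ), (∀ x κ, U₀ x κ ∈ unitaryUnits 𝔸) → (∀ x κ, W x κ ∈ unitaryUnits 𝔸) →
    InAk L k η α₀ Ω U₀ → InAk L k η α₀ Ω (mulCfg W U₀) → IsLandau138W L k η (Ω 0) (Λs k) U₀ W →
    ∀ A' : Site d → Fin d → 𝔸, (∀ y τ, IsSelfAdjoint (A' y τ)) →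
    (∀ j, j ≤ k → ∀ (y : Site d) (τ : Fin d), SideTouches (Ω j) y τ →
      W y τ = cfgExp η A' y τ ∧ ‖A' y τ‖ ≤ α₂ * ((L : ℝ) ^ j * η)⁻¹) →
    (∀ (y : Site d) (τ : Fin d), (∀ j, j ≤ k → ¬ SideTouches (Ω j) y τ) → A' y τ = 0) →
    msup L k η (-(1 : ℝ)) (fun j (b : Site d × Fin d) => SideTouches (Ω j) b.1 b.2) (fun b => A' b.1 b.2)
        ≤ B₀ * (bondNorm L k η (-(3 : ℝ)) Ω (fun x μ => Jcur η U₀ A' μ x)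
          + wsup 1 (fun p : {p : ℕ × (Site d × Fin d) // p.1 ≤ k ∧ (p.2 ∈ Λb k p.1 ∨ (p.1 = 0 ∧ CrossB (Ω 0) p.2))} =>
              linCovIter L U₀ (iEta η A') p.1.1 p.1.2.1 p.1.2.2))
          + Bbd * msup L k η (-(1 : ℝ)) (fun j (b : Site d × Fin d) => j = 0 ∧ SideTouches (Ω 0) b.1 b.2 ∧ ¬ BondTouches (Ω 0) b.1 b.2)
              (fun b => A' b.1 b.2) ∧
      msup L k η (-(2 : ℝ)) (fun j (t : Fin d × Fin d × Site d) => SideTouches (Ω j) t.2.2 t.2.1)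
          (fun t => covDerivFwd η U₀ t.1 (fun z => A' z t.2.1) t.2.2)
        ≤ B₀ * (bondNorm L k η (-(3 : ℝ)) Ω (fun x μ => Jcur η U₀ A' μ x)
          + wsup 1 (fun p : {p : ℕ × (Site d × Fin d) // p.1 ≤ k ∧ (p.2 ∈ Λb k p.1 ∨ (p.1 = 0 ∧ CrossB (Ω 0) p.2))} =>
              linCovIter L U₀ (iEta η A') p.1.1 p.1.2.1 p.1.2.2))
          + Bbd * msup L k η (-(1 : ℝ)) (fun j (b : Site d × Fin d) => j = 0 ∧ SideTouches (Ω 0) b.1 b.2 ∧ ¬ BondTouches (Ω 0) b.1 b.2)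
              (fun b => A' b.1 b.2) ∧
      bondNorm L k η (-(3 : ℝ)) Ω (fun x μ => pdiv η U₀ (plaqCovDeriv η U₀ A') μ x)
        ≤ B₀ * (bondNorm L k η (-(3 : ℝ)) Ω (fun x μ => Jcur η U₀ A' μ x)
          + wsup 1 (fun p : {p : ℕ × (Site d × Fin d) // p.1 ≤ k ∧ (p.2 ∈ Λb k p.1 ∨ (p.1 = 0 ∧ CrossB (Ω 0) p.2))} =>
              linCovIter L U₀ (iEta η A') p.1.1 p.1.2.1 p.1.2.2))
          + Bbd * msup L k η (-(1 : ℝ)) (fun j (b : Site d × Fin d) => j = 0 ∧ SideTouches (Ω 0) b.1 b.2 ∧ ¬ BondTouches (Ω 0) b.1 b.2)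
              (fun b => A' b.1 b.2) ∧
      bondNorm L k η (-(3 : ℝ)) Ω (fun x μ => covLap η U₀ (fun z => A' z μ) x)
        ≤ B₀ * (bondNorm L k η (-(3 : ℝ)) Ω (fun x μ => Jcur η U₀ A' μ x)
          + wsup 1 (fun p : {p : ℕ × (Site d × Fin d) // p.1 ≤ k ∧ (p.2 ∈ Λb k p.1 ∨ (p.1 = 0 ∧ CrossB (Ω 0) p.2))} =>
              linCovIter L U₀ (iEta η A') p.1.1 p.1.2.1 p.1.2.2))
          + Bbd * msup L k η (-(1 : ℝ)) (fun j (b : Site d × Fin d) => j = 0 ∧ SideTouches (Ω 0) b.1 b.2 ∧ ¬ BondTouches (Ω 0) b.1 b.2)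
              (fun b => A' b.1 b.2)

/-- `SockB9P3D4β` is antitone in the threshold `cP`. [cite: Balaban1985RegularSpaces, (1.59) p.86] -/
theorem sockB9P3D4β_anti {L : ℕ} {B₀ Bbd cP cP' : ℝ} (h : cP' ≤ cP) {η : ℝ} {k : ℕ} {Ω : ℕ → Set (Site d)} {Λs : ℕ → ℕ → Set (Site d)}
    {Λb : ℕ → ℕ → Set (Site d × Fin d)} (S : SockB9P3D4β (𝔸 := 𝔸) L B₀ Bbd cP η k Ω Λs Λb) :
    SockB9P3D4β (𝔸 := 𝔸) L B₀ Bbd cP' η k Ω Λs Λb :=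
  fun α₀ α₂ hα₀ hα₀c hα₂ hα₂c => S α₀ α₂ hα₀ (hα₀c.trans h) hα₂ (hα₂c.trans h)

end Socket

/-! ## §2 The averaging binder in the β currency and the restriction lemma -/

section Binder

variable (L : ℕ)

/-- ★ **THE AVERAGING TERM IS BOUNDED BY `|B₁|β`, AT ONE MEMBER** — `B9SupplySockB9P3ZdAt.AvgAt` with the β datum: (3.16) «⟨A, Q*aQA⟩ = Σ_j a Σ_{b∈Λ_j} …»,
whose `j = 0` set contains the crossing bonds of `Ω₀` (star rule), read with B8 (1.56)∕(1.58): `(Lʲη)³|(Σ_j(Lʲη)⁻²Q*_jΛ_jQ_jA)(b)| ≤ q·|B₁|β(A)`.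
[cite: Balaban1985BackgroundPropagators, (3.16) p.393; Balaban1985RegularSpaces, (1.56), (1.58) p.86, (1.31) p.82, p.77] -/
def AvgAtβ (ops : ℝ → ZdIdx d L → ℕ → OpsZd d 𝔸) (q : ℝ) (M : ℝ) (i : ZdIdx d L) (m : ℕ) : Prop :=
  ∀ (U₀ : Site d → Fin d → 𝔸ˣ), (∀ x κ, U₀ x κ ∈ unitaryUnits 𝔸) →
    ∀ A : Site d → Fin d → 𝔸, OnDom L m i.η i.Ω A → ∀ j, j ≤ m → ∀ (x : Site d) (μ : Fin d), BondTouches (i.Ω j) x μ →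
      ((L : ℝ) ^ j * i.η) ^ 3 * ‖(ops M i m).QQ U₀ A x μ‖ ≤
        q * wsup 1 (fun p : {p : ℕ × (Site d × Fin d) // p.1 ≤ m ∧ (p.2 ∈ i.Λb m p.1 ∨ (p.1 = 0 ∧ CrossB (i.Ω 0) p.2))} =>
              linCovIter L U₀ (iEta i.η A) p.1.1 p.1.2.1 p.1.2.2)

variable {L}

/-- **`|B₁|β` does not see the outer part**: `|B₁|β(𝟙_{Ω₀}A) = |B₁|β(A)` — on the constraint bonds by `hbox` + locality of `Q_j`
(`B9Ineq3137LocalSup.linCovIter_congr`), on the crossing bonds because they touch `Ω₀` (level 0, `Q₀ = 1`). [cite: Balaban1985RegularSpaces, (1.56) p.86, p.77; Balaban1985Averaging, p.24 (after (43))] -/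
theorem wsupB1β_restrictDom (hL : 1 ≤ L) (m : ℕ) (η : ℝ) {Ω : ℕ → Set (Site d)} {Λb : ℕ → ℕ → Set (Site d × Fin d)}
    (hbox : ∀ j, j ≤ m → ∀ c ∈ Λb m j, ∀ x, InBox (loK L j c.1) (bondHiK L j c.1 c.2) x → x ∈ Ω 0)
    (U₀ : Site d → Fin d → 𝔸ˣ) (A : Site d → Fin d → 𝔸) :
    wsup 1 (fun p : {p : ℕ × (Site d × Fin d) // p.1 ≤ m ∧ (p.2 ∈ Λb m p.1 ∨ (p.1 = 0 ∧ CrossB (Ω 0) p.2))} =>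
        linCovIter L U₀ (iEta η (restrictDom (Ω 0) A)) p.1.1 p.1.2.1 p.1.2.2) =
      wsup 1 (fun p : {p : ℕ × (Site d × Fin d) // p.1 ≤ m ∧ (p.2 ∈ Λb m p.1 ∨ (p.1 = 0 ∧ CrossB (Ω 0) p.2))} =>
        linCovIter L U₀ (iEta η A) p.1.1 p.1.2.1 p.1.2.2) := by
  have h : (fun p : {p : ℕ × (Site d × Fin d) // p.1 ≤ m ∧ (p.2 ∈ Λb m p.1 ∨ (p.1 = 0 ∧ CrossB (Ω 0) p.2))} =>
        linCovIter L U₀ (iEta η (restrictDom (Ω 0) A)) p.1.1 p.1.2.1 p.1.2.2) =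
      fun p : {p : ℕ × (Site d × Fin d) // p.1 ≤ m ∧ (p.2 ∈ Λb m p.1 ∨ (p.1 = 0 ∧ CrossB (Ω 0) p.2))} =>
        linCovIter L U₀ (iEta η A) p.1.1 p.1.2.1 p.1.2.2 := by
    funext p
    rcases p.2.2 with hc | ⟨h0, hx⟩
    · refine B9Ineq3137LocalSup.linCovIter_congr L hL p.1.1 p.1.2.1 p.1.2.2 (fun _ _ _ _ => rfl) fun x κ hx _ => ?_
      have hxΩ : x ∈ Ω 0 := hbox p.1.1 p.2.1 p.1.2 hc x hx
      simp only [iEta, restrictDom_of A (Or.inl hxΩ : BondTouches (Ω 0) x κ)]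
    · obtain ⟨⟨j, b⟩, hj, _⟩ := p
      dsimp only at h0 hx ⊢
      subst h0
      simp only [B7Prop4GeneralLevels.linCovIter_zero, iEta, restrictDom_of A hx.1]
  rw [h]

end Binder

/-! ## §3 The member supplier in the β currency ([4] Theorem 3.3 ⇒ the four-line collar socket β) -/

section Supply

variable [Nontrivial 𝔸]
variable {I : Type} (geo : I → B9.Geometry) (bg : I → B9.Backgrounds) (GA : ∀ i, B9.KernelFamily (geo i) (bg i))
variable (L : ℕ) (mem : ℝ → ZdIdx d L → ℕ → I)
variable (ιCfg : ∀ (M : ℝ) (i : ZdIdx d L) (m : ℕ) (U₀ : Site d → Fin d → 𝔸ˣ),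
  (∀ x κ, U₀ x κ ∈ unitaryUnits 𝔸) → (bg (mem M i m)).Cfg)
variable (ιLoc : ∀ (M : ℝ) (i : ZdIdx d L) (m : ℕ), (Site d → Fin d → 𝔸) → (geo (mem M i m)).Loc)
variable (ops : ℝ → ZdIdx d L → ℕ → OpsZd d 𝔸)

set_option maxHeartbeats 400000 in
/-- ★★ **THEOREM 3.3 FOR G(U₀) AT ONE MEMBER WITH `Margin2` SUPPLIES THE β COLLAR SOCKET AT THAT DATUM AND LEVEL** — `B9SupplySockB9P3ZdAt.sockB9P3D4_at'`
re-proved VERBATIM with `AvgAt ↦ AvgAtβ`, `|B₁| ↦ |B₁|β` (B8 p. 86 «Theorem 3.3 of [4] implies the bounds (1.59)», on E(Ω₀), with the Δ′-transfer G-IF-01 and the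
collar bookkeeping); same constants B₀′ = max{1, 2B₀max{1,q}}, B_∂ = (20d+2)B₀′, cP = min{1∕16, c₆∕M, a₀∕(K₆M), a₃∕(K₆M), 1∕(2B₀c₆₉K₆M+1)}.
[cite: Balaban1985RegularSpaces, (1.58)–(1.59) p.86, Prop. 3 p.87, p.77; Balaban1985BackgroundPropagators, Thm 3.3 p.399, (3.26)–(3.27) p.395, (3.47) p.398, (3.69) p.404] -/
theorem sockB9P3D4β_at (hd2 : 2 ≤ d) (hL : 1 ≤ L) {c35 c₆ K₆ a₃ c69 q : ℝ}
    {M : ℝ} (hM1 : 1 ≤ M) (i : ZdIdx d L) (hMi : Margin2 i.Ω) {m : ℕ} (hm : m ≤ i.k)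
    (hdict : DictAt geo bg GA L mem ιCfg ιLoc ops M i m) (hP6 : Prop6At bg L mem ιCfg c35 c₆ K₆ M i m)
    (hinv : InvAt bg L mem ιCfg ops c35 a₃ M i m) (hcurv : CurvAt bg L mem ιCfg ops c35 a₃ c69 M i m)
    (hlan : LandauAt bg L mem ιCfg ops c35 a₃ M i m) (havg : AvgAtβ L ops q M i m)
    (hK₆ : 0 < K₆) (hc69 : 0 ≤ c69) (hq : 0 ≤ q)
    {B₀ δ₀ a₀ : ℝ} (hB₀ : 0 < B₀)
    (h33U : ∀ (α₀ : ℝ) (U₀ : Site d → Fin d → 𝔸ˣ) (hU₀ : ∀ x κ, U₀ x κ ∈ unitaryUnits 𝔸), 0 < α₀ → M * α₀ ≤ a₀ →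
      (bg (mem M i m)).Reg335 c35 α₀ (ιCfg M i m U₀ hU₀) →
      B9.Ineq342_346_347 (GA (mem M i m)) B₀ δ₀ (ιCfg M i m U₀ hU₀)) :
    SockB9P3D4β (𝔸 := 𝔸) L (max 1 (2 * B₀ * max 1 q)) ((20 * d + 2) * max 1 (2 * B₀ * max 1 q))
      (min (1 / 16) (min (c₆ / M) (min (a₀ / (K₆ * M)) (min (a₃ / (K₆ * M)) (1 / (2 * B₀ * c69 * K₆ * M + 1))))))
      i.η m i.Ω i.Λs i.Λb := by
  intro α₀ α₂ hα₀ hα₀c hα₂ hα₂c U₀ W hU₀ hWu hInA _ hLanW A' _ h41 hA0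
  -- the thresholds
  have hη : 0 < i.η := i.hη
  have hLr : (1 : ℝ) ≤ L := by exact_mod_cast hL
  have hd1 : (1 : ℝ) ≤ d := by exact_mod_cast (le_trans (by norm_num) hd2 : 1 ≤ d)
  have hM0 : 0 < M := lt_of_lt_of_le one_pos hM1
  have hKM : 0 < K₆ * M := mul_pos hK₆ hM0
  simp only [le_min_iff] at hα₀c hα₂c
  obtain ⟨-, hα₀c6, hα₀a0, hα₀a3, hα₀θ⟩ := hα₀c
  obtain ⟨hα₂16, -, -, -, -⟩ := hα₂c
  have hc6 : M * α₀ ≤ c₆ := by rw [mul_comm]; exact (le_div_iff₀ hM0).1 hα₀c6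
  have ha₉0 : 0 < K₆ * α₀ := mul_pos hK₆ hα₀
  have ha0' : M * (K₆ * α₀) ≤ a₀ := by
    have h := (le_div_iff₀ hKM).1 hα₀a0
    calc M * (K₆ * α₀) = α₀ * (K₆ * M) := by ring
      _ ≤ a₀ := h
  have ha3' : M * (K₆ * α₀) ≤ a₃ := by
    have h := (le_div_iff₀ hKM).1 hα₀a3
    calc M * (K₆ * α₀) = α₀ * (K₆ * M) := by ring
      _ ≤ a₃ := h
  have hκ' : 0 ≤ c69 * M * (K₆ * α₀) := by positivity
  have hθ : B₀ * (c69 * M * (K₆ * α₀)) ≤ 1 / 2 := by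
    have hpos : 0 < 2 * B₀ * c69 * K₆ * M + 1 := by positivity
    have h1 : α₀ * (2 * B₀ * c69 * K₆ * M + 1) ≤ 1 := (le_div_iff₀ hpos).1 hα₀θ
    linarith [hα₀.le]
  -- (3.35) for U₀ by Proposition 6, and Theorem 3.3's (3.42)–(3.47) block for G(U₀)
  have hreg : (bg (mem M i m)).Reg335 c35 (K₆ * α₀) (ιCfg M i m U₀ hU₀) := hP6 α₀ U₀ hU₀ hα₀ hc6 hInA
  have h347 := h33U (K₆ * α₀) U₀ hU₀ ha₉0 ha0' hreg
  obtain ⟨-, hd⟩ := hdict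
  have hU₀1 : ∀ x κ, U₀ x κ ∈ U1 𝔸 := fun x κ => unitaryUnits_le_U1 (hU₀ x κ)
  -- the datum and its restriction to the Ω₀-bonds
  have hAglob : ∀ (y : Site d) (τ : Fin d), ‖A' y τ‖ ≤ α₂ * i.η⁻¹ := by
    intro y τ
    by_cases hmem : ∃ j, j ≤ m ∧ SideTouches (i.Ω j) y τ
    · obtain ⟨j, hj, hs⟩ := hmem
      have hLj : (1 : ℝ) ≤ (L : ℝ) ^ j := one_le_pow₀ hLr
      calc ‖A' y τ‖ ≤ α₂ * ((L : ℝ) ^ j * i.η)⁻¹ := (h41 j hj y τ hs).2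
        _ = α₂ * i.η⁻¹ * ((L : ℝ) ^ j)⁻¹ := by rw [mul_inv]; ring
        _ ≤ α₂ * i.η⁻¹ * 1 := by
            apply mul_le_mul_of_nonneg_left (inv_le_one_of_one_le₀ hLj) (by positivity)
        _ = α₂ * i.η⁻¹ := mul_one _
    · rw [hA0 y τ fun j hj hs => hmem ⟨j, hj, hs⟩, norm_zero]
      positivity
  have hAbd : Bdd L m i.η (-(1 : ℝ)) (fun j (b : Site d × Fin d) => SideTouches (i.Ω j) b.1 b.2) (fun b => A' b.1 b.2) := by
    have e1 : (-(1 : ℝ)) = -((1 : ℕ) : ℝ) := by norm_num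
    rw [e1]
    refine B8ScaledSupNorm.bdd_of_forall (c := α₂) fun j hj b hb => ?_
    rw [B8ScaledSupNorm.weight_neg_natCast, pow_one]
    have h := (h41 j hj b.1 b.2 hb).2
    have hs : 0 < (L : ℝ) ^ j * i.η := B8ScaledSupNorm.scale_pos hL hη j
    calc (L : ℝ) ^ j * i.η * ‖A' b.1 b.2‖ ≤ (L : ℝ) ^ j * i.η * (α₂ * ((L : ℝ) ^ j * i.η)⁻¹) :=
          mul_le_mul_of_nonneg_left h hs.le
      _ = α₂ := by rw [mul_comm α₂, ← mul_assoc, mul_inv_cancel₀ hs.ne', one_mul]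
  obtain ⟨Ain, hAin_def⟩ : ∃ Ain : Site d → Fin d → 𝔸, Ain = restrictDom (i.Ω 0) A' := ⟨_, rfl⟩
  have h41b : ∀ j, j ≤ m → ∀ (y : Site d) (τ : Fin d), SideTouches (i.Ω j) y τ → ‖A' y τ‖ ≤ α₂ * ((L : ℝ) ^ j * i.η)⁻¹ :=
    fun j hj y τ hs => (h41 j hj y τ hs).2
  have hOn : OnDom L m i.η i.Ω Ain := by
    rw [hAin_def]; exact B9SupplySockB9P3ZdLettersOmega.onDom_restrictDom hL hη h41b
  have hAin_glob : ∀ (y : Site d) (τ : Fin d), ‖Ain y τ‖ ≤ α₂ * i.η⁻¹ := fun y τ => by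
    rw [hAin_def]; exact (B9SupplySockB9P3ZdLettersOmega.norm_restrictDom_le _ A' y τ).trans (hAglob y τ)
  obtain ⟨a, ha_def⟩ : ∃ a : ℝ,
      a = msup L m i.η (-(1 : ℝ)) (fun j (b : Site d × Fin d) => SideTouches (i.Ω j) b.1 b.2) (fun b => Ain b.1 b.2) := ⟨_, rfl⟩
  have ha0 : 0 ≤ a := by rw [ha_def]; exact B8ScaledSupNorm.msup_nonneg L m hη.le _ _ _
  -- the collar functional Φ₀ and the pointwise control of the outer part
  obtain ⟨Φ, hΦ_def⟩ : ∃ Φ : ℝ, Φ = msup L m i.η (-(1 : ℝ))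
      (fun j (b : Site d × Fin d) => j = 0 ∧ SideTouches (i.Ω 0) b.1 b.2 ∧ ¬ BondTouches (i.Ω 0) b.1 b.2) (fun b => A' b.1 b.2) := ⟨_, rfl⟩
  have hΦ0 : 0 ≤ Φ := by rw [hΦ_def]; exact B8ScaledSupNorm.msup_nonneg L m hη.le _ _ _
  have hbdΦ : Bdd L m i.η (-(1 : ℝ))
      (fun j (b : Site d × Fin d) => j = 0 ∧ SideTouches (i.Ω 0) b.1 b.2 ∧ ¬ BondTouches (i.Ω 0) b.1 b.2) (fun b => A' b.1 b.2) := by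
    have e1 : (-(1 : ℝ)) = -((1 : ℕ) : ℝ) := by norm_num
    rw [e1]
    exact B9SupplySockB9P3ZdLettersOmega.bdd_neg_of_pointwise hL hη 1 fun b => hAglob b.1 b.2
  have hout : ∀ (y : Site d) (τ : Fin d), ‖outerPart (i.Ω 0) A' y τ‖ ≤ i.η⁻¹ * Φ := by
    intro y τ; rw [hΦ_def]
    exact B9SupplySockB9P3ZdLettersOmega.norm_outerPart_le_phi hη hMi hA0 hbdΦ y τ
  -- the Landau condition for A′, hence for 𝟙_{Ω₀}A′; the source J̃ = Δ_a(U₀)𝟙_{Ω₀}A′ and 𝟙_{Ω₀}A′ = G(U₀)J̃ ((1.58))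
  have hLanA : IsLandau138 L m i.η (i.Ω 0) (i.Λs m) U₀ A' :=
    B9SupplySockB9P3Zd.landau_of_landauW hd2 hη U₀ hWu hα₂16 h41 hLanW
  have hLanAin : IsLandau138 L m i.η (i.Ω 0) (i.Λs m) U₀ Ain := by
    rw [hAin_def]; exact (B9SupplySockB9P3ZdLettersOmega.isLandau138_restrictDom_iff L m i.η (i.Ω 0) (i.Λs m) U₀ A').2 hLanA
  obtain ⟨Jt, hJt_def⟩ : ∃ Jt : Site d → Fin d → 𝔸, Jt = deltaAOf i.η (ops M i m) U₀ Ain := ⟨_, rfl⟩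
  have hGJ : (ops M i m).Gop U₀ Jt = Ain :=
    hinv (K₆ * α₀) U₀ hU₀ ha₉0 ha3' hreg Ain hOn Jt fun y τ _ => by rw [hJt_def]
  have hDRD : ∀ (x : Site d) (μ : Fin d), (ops M i m).DRDs U₀ Ain x μ = 0 :=
    hlan (K₆ * α₀) U₀ hU₀ ha₉0 ha3' hreg Ain hOn hLanAin
  have hJtb : ∀ (x : Site d) (μ : Fin d),
      Jt x μ = Jcur i.η U₀ Ain μ x + (ops M i m).Dp U₀ Ain x μ + (ops M i m).DRDs U₀ Ain x μ + (ops M i m).QQ U₀ Ain x μ := by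
    intro x μ; rw [hJt_def]; rfl
  -- the right-hand side quantities: |J|₍₋₃₎ of the datum, |J(𝟙_{Ω₀}A′)|₍₋₃₎, |B₁|
  obtain ⟨nJ, hnJ_def⟩ : ∃ nJ : ℝ, nJ = bondNorm L m i.η (-(3 : ℝ)) i.Ω (fun x μ => Jcur i.η U₀ A' μ x) := ⟨_, rfl⟩
  obtain ⟨nJi, hnJi_def⟩ : ∃ nJi : ℝ, nJi = bondNorm L m i.η (-(3 : ℝ)) i.Ω (fun x μ => Jcur i.η U₀ Ain μ x) := ⟨_, rfl⟩
  obtain ⟨nB, hnB_def⟩ : ∃ nB : ℝ, nB = wsup 1 (fun p : {p : ℕ × (Site d × Fin d) // p.1 ≤ m ∧ (p.2 ∈ i.Λb m p.1 ∨ (p.1 = 0 ∧ CrossB (i.Ω 0) p.2))} =>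
      linCovIter L U₀ (iEta i.η A') p.1.1 p.1.2.1 p.1.2.2) := ⟨_, rfl⟩
  have hnJ0 : 0 ≤ nJ := by rw [hnJ_def]; exact B8ScaledSupNorm.msup_nonneg L m hη.le _ _ _
  have hnB0 : 0 ≤ nB := by rw [hnB_def]; exact B8Eq155JBound.wsup_nonneg zero_le_one _
  have hnB_eq : wsup 1 (fun p : {p : ℕ × (Site d × Fin d) // p.1 ≤ m ∧ (p.2 ∈ i.Λb m p.1 ∨ (p.1 = 0 ∧ CrossB (i.Ω 0) p.2))} =>
      linCovIter L U₀ (iEta i.η Ain) p.1.1 p.1.2.1 p.1.2.2) = nB := by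
    rw [hnB_def, hAin_def]
    exact wsupB1β_restrictDom hL m i.η (B9SupplySockB9P3ZdLettersOmega.hbox_zero i hm) U₀ A'
  -- |J(𝟙_{Ω₀}A′)|₍₋₃₎ ≤ |J(A′)|₍₋₃₎ + 16dΦ (the outer part sits at level 0)
  have hnJi_le : nJi ≤ nJ + 16 * d * Φ := by
    rw [hnJi_def, hnJ_def, hAin_def]
    exact B9SupplySockB9P3ZdLettersOmega.bondNorm_jcur_restrict_le hL hη hMi hU₀1 hΦ0 hout hAglob
  -- the current of 𝟙_{Ω₀}A′ is bounded
  have hgrad : ∀ (y : Site d) (κ τ : Fin d), ‖covDerivFwd i.η U₀ κ (fun z => Ain z τ) y‖ ≤ i.η⁻¹ * (α₂ * i.η⁻¹ + α₂ * i.η⁻¹) :=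
    fun y κ τ => (B9SupplySockB9P3ZdLettersOmega.norm_covDerivFwd_le hη (hU₀1 _ _) _).trans
      (mul_le_mul_of_nonneg_left (add_le_add (hAin_glob _ _) (hAin_glob _ _)) (inv_nonneg.mpr hη.le))
  have hJbd : Bdd L m i.η (-(3 : ℝ)) (fun j (b : Site d × Fin d) => BondTouches (i.Ω j) b.1 b.2)
      (fun b => Jcur i.η U₀ Ain b.2 b.1) :=
    B9SupplySockB9P3Zd.bdd_neg_three_of_pointwise hL hη fun b => B9SupplySockB9P3Zd.norm_Jcur_le_of_grad hη hU₀1 hgrad b.2 b.1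
  -- |J̃|₍₋₃₎ ≤ |J(𝟙_{Ω₀}A′)|₍₋₃₎ + c₆₉ M α₀ |𝟙_{Ω₀}A′|₍₋₁₎ + q |B₁| (pointwise: (3.26) with (3.69), the Landau condition, (3.16))
  have hJt : bondNorm L m i.η (-(3 : ℝ)) i.Ω Jt ≤ nJi + c69 * M * (K₆ * α₀) * a + q * nB := by
    have e3 : (-(3 : ℝ)) = -((3 : ℕ) : ℝ) := by norm_num
    have hnJi0 : 0 ≤ nJi := by rw [hnJi_def]; exact B8ScaledSupNorm.msup_nonneg L m hη.le _ _ _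
    refine B8ScaledSupNorm.msup_le (by positivity) fun j hj b hb => ?_
    have hw : weight L i.η (-(3 : ℝ)) j = ((L : ℝ) ^ j * i.η) ^ 3 := by
      rw [e3, B8ScaledSupNorm.weight_neg_natCast]
    have hw0 : 0 ≤ ((L : ℝ) ^ j * i.η) ^ 3 := by positivity
    have h1 : weight L i.η (-(3 : ℝ)) j * ‖Jcur i.η U₀ Ain b.2 b.1‖ ≤ nJi := by
      rw [hnJi_def]; exact B8ScaledSupNorm.weight_mul_norm_le_msup hJbd hj hb
    have h2 : ((L : ℝ) ^ j * i.η) ^ 3 * ‖(ops M i m).Dp U₀ Ain b.1 b.2‖ ≤ c69 * M * (K₆ * α₀) * a := by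
      rw [ha_def]; exact hcurv (K₆ * α₀) U₀ hU₀ ha₉0 ha3' hreg Ain hOn j hj b.1 b.2 hb
    have h4 : ((L : ℝ) ^ j * i.η) ^ 3 * ‖(ops M i m).QQ U₀ Ain b.1 b.2‖ ≤ q * nB := by
      rw [← hnB_eq]; exact havg U₀ hU₀ Ain hOn j hj b.1 b.2 hb
    have hsum : ‖Jt b.1 b.2‖ ≤
        ‖Jcur i.η U₀ Ain b.2 b.1‖ + ‖(ops M i m).Dp U₀ Ain b.1 b.2‖ + ‖(ops M i m).QQ U₀ Ain b.1 b.2‖ := by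
      rw [hJtb, hDRD b.1 b.2, add_zero]
      exact norm_add₃_le
    rw [hw] at h1 ⊢
    calc ((L : ℝ) ^ j * i.η) ^ 3 * ‖Jt b.1 b.2‖
        ≤ ((L : ℝ) ^ j * i.η) ^ 3 *
            (‖Jcur i.η U₀ Ain b.2 b.1‖ + ‖(ops M i m).Dp U₀ Ain b.1 b.2‖ + ‖(ops M i m).QQ U₀ Ain b.1 b.2‖) :=
          mul_le_mul_of_nonneg_left hsum hw0
      _ = ((L : ℝ) ^ j * i.η) ^ 3 * ‖Jcur i.η U₀ Ain b.2 b.1‖ + ((L : ℝ) ^ j * i.η) ^ 3 * ‖(ops M i m).Dp U₀ Ain b.1 b.2‖ +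
            ((L : ℝ) ^ j * i.η) ^ 3 * ‖(ops M i m).QQ U₀ Ain b.1 b.2‖ := by ring
      _ ≤ nJi + c69 * M * (K₆ * α₀) * a + q * nB := add_le_add (add_le_add h1 h2) h4
  -- Theorem 3.3's γ = −3 entries at J̃ through the dictionary ((3.47) ⇒ (1.59) for 𝟙_{Ω₀}A′)
  obtain ⟨hw, hG0, hG1, hG3⟩ := hd U₀ hU₀ Jt
  have hline1 : a ≤ B₀ * bondNorm L m i.η (-(3 : ℝ)) i.Ω Jt := by
    have h := B9.glob_at_minus_three (GA (mem M i m)) h347 0 (ιLoc M i m Jt)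
    rw [hG0, hw, hGJ, ← ha_def] at h
    exact h
  have hline2 : msup L m i.η (-(2 : ℝ)) (fun j (t : Fin d × Fin d × Site d) => SideTouches (i.Ω j) t.2.2 t.2.1)
      (fun t => covDerivFwd i.η U₀ t.1 (fun z => Ain z t.2.1) t.2.2) ≤ B₀ * bondNorm L m i.η (-(3 : ℝ)) i.Ω Jt := by
    have h := B9.glob_at_minus_three (GA (mem M i m)) h347 1 (ιLoc M i m Jt)
    rw [hG1, hw, hGJ] at h
    exact h
  have hline4 : bondNorm L m i.η (-(3 : ℝ)) i.Ω (fun x μ => covLap i.η U₀ (fun z => Ain z μ) x) ≤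
      B₀ * bondNorm L m i.η (-(3 : ℝ)) i.Ω Jt := by
    have h := B9.glob_at_minus_three (GA (mem M i m)) h347 3 (ιLoc M i m Jt)
    rw [hG3, hw, hGJ] at h
    exact h
  -- the a-priori (Neumann) step of G-IF-01 for 𝟙_{Ω₀}A′ with the source norm nJ + 16dΦ
  have hN : bondNorm L m i.η (-(3 : ℝ)) i.Ω Jt ≤ (nJ + 16 * d * Φ) + c69 * M * (K₆ * α₀) * a + q * nB := by
    linarith only [hJt, hnJi_le]
  have hnJ1 : 0 ≤ nJ + 16 * d * Φ := by positivity
  obtain ⟨hA1, hA2, -, hA4, -⟩ := B9SupplySockB9P3Zd.apriori_arith (h := 0) (Cβ := 0) hB₀ hq hκ' hθ ha0 hnJ1 hnB0 le_rfl rfl hN hline1 hline2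
    hline4 (by rw [zero_mul])
  -- bookkeeping constants
  obtain ⟨B', hB'_def⟩ : ∃ B' : ℝ, B' = max 1 (2 * B₀ * max 1 q) := ⟨_, rfl⟩
  have hB'1 : 1 ≤ B' := by rw [hB'_def]; exact le_max_left _ _
  rw [← hB'_def] at hA1 hA2 hA4 ⊢
  -- the four lines for A′ = 𝟙_{Ω₀}A′ + outer part
  have hL1 : msup L m i.η (-(1 : ℝ)) (fun j (b : Site d × Fin d) => SideTouches (i.Ω j) b.1 b.2) (fun b => A' b.1 b.2) ≤ a + Φ := by
    rw [ha_def, hAin_def]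
    exact B9SupplySockB9P3ZdLettersOmega.msup_side_le_restrict_add hη hMi hΦ0 hout hAbd
  have hL2 : msup L m i.η (-(2 : ℝ)) (fun j (t : Fin d × Fin d × Site d) => SideTouches (i.Ω j) t.2.2 t.2.1)
      (fun t => covDerivFwd i.η U₀ t.1 (fun z => A' z t.2.1) t.2.2) ≤
      msup L m i.η (-(2 : ℝ)) (fun j (t : Fin d × Fin d × Site d) => SideTouches (i.Ω j) t.2.2 t.2.1)
        (fun t => covDerivFwd i.η U₀ t.1 (fun z => Ain z t.2.1) t.2.2) + 2 * Φ := by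
    rw [hAin_def]
    exact B9SupplySockB9P3ZdLettersOmega.msup_grad_le_restrict_add hL hη hMi hU₀1 hΦ0 hout hAglob
  have hL4 : bondNorm L m i.η (-(3 : ℝ)) i.Ω (fun x μ => covLap i.η U₀ (fun z => A' z μ) x) ≤
      bondNorm L m i.η (-(3 : ℝ)) i.Ω (fun x μ => covLap i.η U₀ (fun z => Ain z μ) x) + 4 * d * Φ := by
    rw [hAin_def]
    exact B9SupplySockB9P3ZdLettersOmega.bondNorm_covLap_le_restrict_add hL hη hMi hU₀1 hΦ0 hout hAglob
  have hJJ : bondNorm L m i.η (-(3 : ℝ)) i.Ω (fun x μ => pdiv i.η U₀ (plaqCovDeriv i.η U₀ A') μ x) = nJ := by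
    rw [hnJ_def]; rfl
  -- name the remaining large terms, so that the final arithmetic runs on atoms
  obtain ⟨l1, hl1_def⟩ : ∃ l1 : ℝ,
      l1 = msup L m i.η (-(1 : ℝ)) (fun j (b : Site d × Fin d) => SideTouches (i.Ω j) b.1 b.2) (fun b => A' b.1 b.2) := ⟨_, rfl⟩
  obtain ⟨l2, hl2_def⟩ : ∃ l2 : ℝ, l2 = msup L m i.η (-(2 : ℝ)) (fun j (t : Fin d × Fin d × Site d) => SideTouches (i.Ω j) t.2.2 t.2.1)
      (fun t => covDerivFwd i.η U₀ t.1 (fun z => A' z t.2.1) t.2.2) := ⟨_, rfl⟩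
  obtain ⟨g2, hg2_def⟩ : ∃ g2 : ℝ, g2 = msup L m i.η (-(2 : ℝ)) (fun j (t : Fin d × Fin d × Site d) => SideTouches (i.Ω j) t.2.2 t.2.1)
      (fun t => covDerivFwd i.η U₀ t.1 (fun z => Ain z t.2.1) t.2.2) := ⟨_, rfl⟩
  obtain ⟨l4, hl4_def⟩ : ∃ l4 : ℝ, l4 = bondNorm L m i.η (-(3 : ℝ)) i.Ω (fun x μ => covLap i.η U₀ (fun z => A' z μ) x) := ⟨_, rfl⟩
  obtain ⟨g4, hg4_def⟩ : ∃ g4 : ℝ, g4 = bondNorm L m i.η (-(3 : ℝ)) i.Ω (fun x μ => covLap i.η U₀ (fun z => Ain z μ) x) := ⟨_, rfl⟩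
  rw [← hl1_def] at hL1
  rw [← hl2_def, ← hg2_def] at hL2
  rw [← hg2_def] at hA2
  rw [← hl4_def, ← hg4_def] at hL4
  rw [← hg4_def] at hA4
  rw [← hnJ_def, ← hnB_def, ← hΦ_def, hJJ, ← hl1_def, ← hl2_def, ← hl4_def]
  have hd4 : (1 : ℝ) ≤ 4 * d + 2 := by linarith only [hd1]
  refine ⟨?_, ?_, ?_, ?_⟩
  · exact collar_arith (e := 1) hB'1 hΦ0 hd4 (by linarith only [hL1, hA1])
  · exact collar_arith (e := 2) hB'1 hΦ0 (by linarith only [hd1]) (by linarith only [hL2, hA2])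
  · refine collar_arith (e := 0) hB'1 hΦ0 (by linarith only [hd1]) ?_
    have h1 : nJ ≤ B' * nJ := le_mul_of_one_le_left hnJ0 hB'1
    have h2 : 0 ≤ B' * (16 * d * Φ + nB) := by positivity
    calc nJ ≤ B' * nJ := h1
      _ ≤ B' * nJ + B' * (16 * d * Φ + nB) := le_add_of_nonneg_right h2
      _ = B' * (nJ + 16 * d * Φ + nB) + 0 * Φ := by ring
  · exact collar_arith (e := 4 * d) hB'1 hΦ0 (by linarith only [hd1]) (by linarith only [hL4, hA4])

/-- ★ **THEOREM 3.3 (BY NAME) SUPPLIES THE β COLLAR SOCKET AT EVERY MEMBER OF AN INDEX MAP WITH `Margin2`, EVERY TRUNCATION LEVEL** —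
`B9SupplySockB9P3ZdAtFamilies.sockB9P3D4_allLevels_of_thm33_on` with `AvgAtβ` ∕ `SockB9P3D4β`. [cite: Balaban1985RegularSpaces, (1.58)–(1.59) p.86, Thm 4 p.88, p.77; Balaban1985BackgroundPropagators, Thm 3.3 p.399, (3.27) p.395] -/
theorem sockB9P3D4β_allLevels_of_thm33_on (hd2 : 2 ≤ d) (hL : 1 ≤ L) {c35 c₆ K₆ M₃ a₃ c69 q : ℝ}
    {Gp : ∀ i, B9.KernelFamily (geo i) (bg i)} (h33 : B9.Thm33Printed c35 geo bg Gp GA)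
    {J : Type*} (ι : J → ZdIdx d L) (hMJ : ∀ j, Margin2 (ι j).Ω)
    (hdict : ∀ (M : ℝ) (j : J) (m : ℕ), DictAt geo bg GA L mem ιCfg ιLoc ops M (ι j) m)
    (hP6 : ∀ (M : ℝ) (j : J) (m : ℕ), M₃ ≤ M → Prop6At bg L mem ιCfg c35 c₆ K₆ M (ι j) m)
    (hinv : ∀ (M : ℝ) (j : J) (m : ℕ), M₃ ≤ M → InvAt bg L mem ιCfg ops c35 a₃ M (ι j) m)
    (hcurv : ∀ (M : ℝ) (j : J) (m : ℕ), M₃ ≤ M → CurvAt bg L mem ιCfg ops c35 a₃ c69 M (ι j) m)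
    (hlan : ∀ (M : ℝ) (j : J) (m : ℕ), M₃ ≤ M → LandauAt bg L mem ιCfg ops c35 a₃ M (ι j) m)
    (havg : ∀ (M : ℝ) (j : J) (m : ℕ), AvgAtβ L ops q M (ι j) m)
    (hc₆ : 0 < c₆) (hK₆ : 0 < K₆) (ha₃ : 0 < a₃) (hc69 : 0 ≤ c69) (hq : 0 ≤ q) :
    ∃ B₀ cP : ℝ, 0 < B₀ ∧ 0 < cP ∧
      ∀ (j : J) (m : ℕ), m ≤ (ι j).k →
        SockB9P3D4β (𝔸 := 𝔸) L (max 1 (2 * B₀ * max 1 q)) ((20 * d + 2) * max 1 (2 * B₀ * max 1 q)) cP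
          (ι j).η m (ι j).Ω (ι j).Λs (ι j).Λb := by
  obtain ⟨M₁, δ₀, a₀, B₀, Bβ, Bε, Bεβ, -, -, ha₀, hB₀, H⟩ := h33
  obtain ⟨M, hM_def⟩ : ∃ M : ℝ, M = max 1 (max M₁ M₃) := ⟨_, rfl⟩
  have hM1 : 1 ≤ M := by rw [hM_def]; exact le_max_left _ _
  have hMM₁ : M₁ ≤ M := by rw [hM_def]; exact (le_max_left _ _).trans (le_max_right _ _)
  have hMM₃ : M₃ ≤ M := by rw [hM_def]; exact (le_max_right _ _).trans (le_max_right _ _)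
  have hM0 : 0 < M := lt_of_lt_of_le one_pos hM1
  have hKM : 0 < K₆ * M := mul_pos hK₆ hM0
  refine ⟨B₀, min (1 / 16) (min (c₆ / M) (min (a₀ / (K₆ * M)) (min (a₃ / (K₆ * M)) (1 / (2 * B₀ * c69 * K₆ * M + 1))))),
    hB₀, ?_, fun j m hm => ?_⟩
  · refine lt_min (by norm_num) (lt_min (div_pos hc₆ hM0) (lt_min (div_pos ha₀ hKM) (lt_min (div_pos ha₃ hKM) ?_)))
    have : 0 < 2 * B₀ * c69 * K₆ * M + 1 := by positivity
    positivity
  · refine sockB9P3D4β_at geo bg GA L mem ιCfg ιLoc ops hd2 hL hM1 (ι j) (hMJ j) hm (hdict M j m) (hP6 M j m hMM₃) (hinv M j m hMM₃)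
      (hcurv M j m hMM₃) (hlan M j m hMM₃) (havg M j m) hK₆ hc69 hq (δ₀ := δ₀) hB₀ fun α₀ U₀ hU₀ hα₀ hMa hreg => ?_
    have hMi : M₁ ≤ (geo (mem M (ι j) m)).M := by rw [(hdict M j m).1]; exact hMM₁
    have hMa' : (geo (mem M (ι j) m)).M * α₀ ≤ a₀ := by rw [(hdict M j m).1]; exact hMa
    exact (H (mem M (ι j) m) hMi α₀ hα₀ hMa' (ιCfg M (ι j) m U₀ hU₀) hreg).2.1

/-- ★ **(EXPLICIT CONSTANTS.)  THE β COLLAR SOCKET FAMILY FROM THEOREM 3.3's `G(U)`-BLOCK AT NAMED CONSTANTS** —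
`B9SupplySockB9P3ZdAtJoint.sockB9P3D4_allLevels_explicit_on` with `AvgAtβ` ∕ `SockB9P3D4β`. [cite: Balaban1985RegularSpaces, (1.59) p.86, Thm 4 p.88, p.77; Balaban1985BackgroundPropagators, Thm 3.3 p.399] -/
theorem sockB9P3D4β_allLevels_explicit_on (hd2 : 2 ≤ d) (hL : 1 ≤ L) {c35 c₆ K₆ M₃ a₃ c69 q : ℝ}
    {M₁ δ₀ a₀ B₀ : ℝ} {Bβ Bε : ℝ → ℝ} {Bεβ : ℝ → ℝ → ℝ} (hB₀ : 0 < B₀)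
    (H : ∀ i : I, M₁ ≤ (geo i).M → ∀ α₀ : ℝ, 0 < α₀ → (geo i).M * α₀ ≤ a₀ →
      ∀ U : (bg i).Cfg, (bg i).Reg335 c35 α₀ U →
        B9.Ineq342_346_347 (GA i) B₀ δ₀ U ∧ B9.Ineq343_345 (GA i) Bβ Bε Bεβ δ₀ U)
    {M : ℝ} (hM1 : 1 ≤ M) (hMM₁ : M₁ ≤ M) (hMM₃ : M₃ ≤ M)
    {J : Type*} (ι : J → ZdIdx d L) (hMJ : ∀ j, Margin2 (ι j).Ω)
    (hdict : ∀ (M : ℝ) (j : J) (m : ℕ), DictAt geo bg GA L mem ιCfg ιLoc ops M (ι j) m)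
    (hP6 : ∀ (M : ℝ) (j : J) (m : ℕ), M₃ ≤ M → Prop6At bg L mem ιCfg c35 c₆ K₆ M (ι j) m)
    (hinv : ∀ (M : ℝ) (j : J) (m : ℕ), M₃ ≤ M → InvAt bg L mem ιCfg ops c35 a₃ M (ι j) m)
    (hcurv : ∀ (M : ℝ) (j : J) (m : ℕ), M₃ ≤ M → CurvAt bg L mem ιCfg ops c35 a₃ c69 M (ι j) m)
    (hlan : ∀ (M : ℝ) (j : J) (m : ℕ), M₃ ≤ M → LandauAt bg L mem ιCfg ops c35 a₃ M (ι j) m)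
    (havg : ∀ (M : ℝ) (j : J) (m : ℕ), AvgAtβ L ops q M (ι j) m)
    (hK₆ : 0 < K₆) (hc69 : 0 ≤ c69) (hq : 0 ≤ q) :
    ∀ (j : J) (m : ℕ), m ≤ (ι j).k →
      SockB9P3D4β (𝔸 := 𝔸) L (max 1 (2 * B₀ * max 1 q)) ((20 * d + 2) * max 1 (2 * B₀ * max 1 q))
        (min (1 / 16) (min (c₆ / M) (min (a₀ / (K₆ * M)) (min (a₃ / (K₆ * M)) (1 / (2 * B₀ * c69 * K₆ * M + 1))))))
        (ι j).η m (ι j).Ω (ι j).Λs (ι j).Λb := by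
  intro j m hm
  refine sockB9P3D4β_at geo bg GA L mem ιCfg ιLoc ops hd2 hL hM1 (ι j) (hMJ j) hm (hdict M j m) (hP6 M j m hMM₃) (hinv M j m hMM₃)
    (hcurv M j m hMM₃) (hlan M j m hMM₃) (havg M j m) hK₆ hc69 hq (δ₀ := δ₀) hB₀ fun α₀ U₀ hU₀ hα₀ hMa hreg => ?_
  have hMi : M₁ ≤ (geo (mem M (ι j) m)).M := by rw [(hdict M j m).1]; exact hMM₁
  have hMa' : (geo (mem M (ι j) m)).M * α₀ ≤ a₀ := by rw [(hdict M j m).1]; exact hMa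
  exact (H (mem M (ι j) m) hMi α₀ hα₀ hMa' (ιCfg M (ι j) m U₀ hU₀) hreg).1

end Supply

/-! ## §4 A6 WITNESS — the hypothesis set of `sockB9P3D4β_at` IS INHABITED at (a cube member, truncation `m = 0`): the trivial massive regime -/

namespace Witness

open B8Eq131CubesAdmissible (cubeFam cubeFam_false_zero)
open B8Eq131Cubes (cube sqLo sqHi)
open B8CubeMemberZd (cubeLamS cubeLamB cubeLamS_self)

/-- The Ω₀-BONDS (p. 77: an end-point in `Ω₀`) as an index type. [cite: Balaban1985RegularSpaces, p.77 (convention before (1.5))] -/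
abbrev TB (Ω₀ : Set (Site d)) : Type := {b : Site d × Fin d // BondTouches Ω₀ b.1 b.2}

/-- A box `Ω₀ = [lo, hi]` of `ℤᵈ` has finitely many Ω₀-bonds (they start in `[lo − 1, hi]`). [cite: Balaban1985RegularSpaces, p.98 («□_j»), p.77] -/
theorem finite_TB_of_box (lo hi : Site d) : (setOf fun b : Site d × Fin d => BondTouches {x | InBox lo hi x} b.1 b.2).Finite := by
  refine ((Set.finite_Icc (lo - 1) hi).prod (Set.finite_univ : (Set.univ : Set (Fin d)).Finite)).subset ?_
  rintro ⟨x, μ⟩ hb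
  simp only [Set.mem_setOf_eq, BondTouches, InBox, Set.mem_setOf_eq] at hb
  have hx : ∀ n, lo n - 1 ≤ x n ∧ x n ≤ hi n := by
    intro n
    rcases hb with h | h
    · exact ⟨by linarith [(h n).1], (h n).2⟩
    · have h1 := (h n).1
      have h2 := (h n).2
      simp only [Pi.add_apply, B7Prop1Explicit.e_apply] at h1 h2
      by_cases hn : n = μ
      · rw [if_pos hn] at h1 h2; exact ⟨by linarith, by linarith⟩
      · rw [if_neg hn] at h1 h2; exact ⟨by linarith, by linarith⟩
  refine ⟨⟨fun n => ?_, fun n => (hx n).2⟩, Set.mem_univ _⟩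
  simp only [Pi.sub_apply, Pi.one_apply]
  exact (hx n).1

section Ops

variable (Ω₀ : Set (Site d))

/-- Restriction of a bond field to the Ω₀-bonds («Ω₀ … a characteristic function of Ω₀», [4] p. 394). [cite: Balaban1985BackgroundPropagators, p.394 (after (3.22)), (3.27) p.395] -/
def restr (J : Site d → Fin d → 𝔸) : TB Ω₀ → 𝔸 := fun b => J b.1.1 b.1.2

open Classical in
/-- Extension by zero off the Ω₀-bonds (Dirichlet). [cite: Balaban1985BackgroundPropagators, p.394 («Dirichlet boundary conditions on Ω₀»), (3.27) p.395] -/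
def extd (v : TB Ω₀ → 𝔸) : Site d → Fin d → 𝔸 := fun x μ => if h : BondTouches Ω₀ x μ then v ⟨(x, μ), h⟩ else 0

/-- `ext v = v` on an Ω₀-bond. [cite: Balaban1985BackgroundPropagators, (3.27) p.395] -/
theorem extd_of {v : TB Ω₀ → 𝔸} {x : Site d} {μ : Fin d} (h : BondTouches Ω₀ x μ) : extd Ω₀ v x μ = v ⟨(x, μ), h⟩ := by
  simp [extd, h]

/-- `ext v = 0` off the Ω₀-bonds. [cite: Balaban1985BackgroundPropagators, (3.27) p.395] -/
theorem extd_of_not {v : TB Ω₀ → 𝔸} {x : Site d} {μ : Fin d} (h : ¬ BondTouches Ω₀ x μ) : extd Ω₀ v x μ = 0 := by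
  simp [extd, h]

/-- `restr ∘ ext = id`. [cite: Balaban1985BackgroundPropagators, (3.27) p.395] -/
theorem restr_extd (v : TB Ω₀ → 𝔸) : restr Ω₀ (extd Ω₀ v) = v := by
  funext b; simp [restr, extd_of Ω₀ b.2]

/-- `ext ∘ restr = id` on fields vanishing off the Ω₀-bonds (the class E(Ω₀)). [cite: Balaban1985BackgroundPropagators, (3.27) p.395] -/
theorem extd_restr {A : Site d → Fin d → 𝔸} (hA : ∀ (y : Site d) (τ : Fin d), ¬ BondTouches Ω₀ y τ → A y τ = 0) :
    extd Ω₀ (restr Ω₀ A) = A := by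
  funext x μ
  by_cases h : BondTouches Ω₀ x μ
  · rw [extd_of Ω₀ h]; rfl
  · rw [extd_of_not Ω₀ h, hA x μ h]

/-- `ext` is additive (difference form). [cite: Balaban1985BackgroundPropagators, (3.27) p.395] -/
theorem extd_sub (v w : TB Ω₀ → 𝔸) : extd Ω₀ v - extd Ω₀ w = extd Ω₀ (v - w) := by
  funext x μ
  by_cases h : BondTouches Ω₀ x μ
  · simp only [Pi.sub_apply, extd_of Ω₀ h]
  · simp only [Pi.sub_apply, extd_of_not Ω₀ h, sub_zero]

/-- `ext 0 = 0`. [cite: Balaban1985BackgroundPropagators, (3.27) p.395] -/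
theorem extd_zero : extd Ω₀ (0 : TB Ω₀ → 𝔸) = 0 := by
  funext x μ
  by_cases h : BondTouches Ω₀ x μ
  · rw [extd_of Ω₀ h]; rfl
  · rw [extd_of_not Ω₀ h]; rfl

/-- `K(U₀) = restr ∘ D*_{U₀}D_{U₀} ∘ ext` — the principal part `D*D` of (3.10)∕(3.26) compressed to the Ω₀-bonds (B8's `J = D*DA`, (1.55)). [cite: Balaban1985BackgroundPropagators, (3.10) p.392, (3.26) p.395; Balaban1985RegularSpaces, (1.55) p.86] -/
def Kop (η : ℝ) (U₀ : Site d → Fin d → 𝔸ˣ) (v : TB Ω₀ → 𝔸) : TB Ω₀ → 𝔸 :=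
  restr Ω₀ (fun x μ => Jcur η U₀ (extd Ω₀ v) μ x)

/-- `K` is additive (difference form; `B9SupplySockB9P3ZdLettersOmega.Jcur_add`). [cite: Balaban1985RegularSpaces, (1.55) p.86] -/
theorem Kop_sub (η : ℝ) (U₀ : Site d → Fin d → 𝔸ˣ) (v w : TB Ω₀ → 𝔸) : Kop Ω₀ η U₀ v - Kop Ω₀ η U₀ w = Kop Ω₀ η U₀ (v - w) := by
  funext b
  have h := B9SupplySockB9P3ZdLettersOmega.Jcur_add η U₀ (extd Ω₀ v - extd Ω₀ w) (extd Ω₀ w) b.1.2 b.1.1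
  rw [sub_add_cancel] at h
  simp only [Kop, restr, Pi.sub_apply, ← extd_sub]
  rw [h]; abel

/-- `K 0 = 0`. [cite: Balaban1985RegularSpaces, (1.55) p.86] -/
theorem Kop_zero (η : ℝ) (U₀ : Site d → Fin d → 𝔸ˣ) : Kop Ω₀ η U₀ (0 : TB Ω₀ → 𝔸) = 0 := by
  funext b
  simp only [Kop, restr, extd_zero, B9SupplySockB9P3ZdLettersOmega.Jcur_zero, Pi.zero_apply]

/-- The mass `a = 32dη⁻²` of the witness (twice the `L^∞` bound of `K(U₀)`). [cite: Balaban1985BackgroundPropagators, (3.16) p.393 («a»)] -/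
def massA (d : ℕ) (η : ℝ) : ℝ := 32 * d * η⁻¹ * η⁻¹

/-- The contraction `Φ_J(v) = a⁻¹(restr J − K(U₀)v)` whose fixed point solves `(K(U₀) + a)v = restr J`. [cite: Balaban1985BackgroundPropagators, (3.26)–(3.27) p.395] -/
def Phi (η : ℝ) (U₀ : Site d → Fin d → 𝔸ˣ) (J : Site d → Fin d → 𝔸) (v : TB Ω₀ → 𝔸) : TB Ω₀ → 𝔸 :=
  (massA d η)⁻¹ • (restr Ω₀ J - Kop Ω₀ η U₀ v)

variable [Fintype (TB Ω₀)]

/-- `‖ext v (b)‖ ≤ ‖v‖` (sup norm on the finite Ω₀-bond space). [cite: Balaban1985BackgroundPropagators, (3.41) p.397] -/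
theorem norm_extd_le (v : TB Ω₀ → 𝔸) (x : Site d) (μ : Fin d) : ‖extd Ω₀ v x μ‖ ≤ ‖v‖ := by
  by_cases h : BondTouches Ω₀ x μ
  · rw [extd_of Ω₀ h]; exact norm_le_pi_norm v ⟨(x, μ), h⟩
  · rw [extd_of_not Ω₀ h, norm_zero]; exact norm_nonneg _

variable [Nontrivial 𝔸]

/-- **`‖K(U₀)v‖ ≤ 16dη⁻²‖v‖` uniformly in the unitary background** (`norm_Jcur_le_of_grad` + `norm_covDerivFwd_le`). [cite: Balaban1985RegularSpaces, (1.55) p.86, (1.1) p.76] -/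
theorem norm_Kop_le {η : ℝ} (hη : 0 < η) {U₀ : Site d → Fin d → 𝔸ˣ} (hU₀ : ∀ x κ, U₀ x κ ∈ unitaryUnits 𝔸) (v : TB Ω₀ → 𝔸) :
    ‖Kop Ω₀ η U₀ v‖ ≤ 16 * d * η⁻¹ * η⁻¹ * ‖v‖ := by
  have hU1 : ∀ y κ, U₀ y κ ∈ U1 𝔸 := fun y κ => unitaryUnits_le_U1 (hU₀ y κ)
  have hG : ∀ (y : Site d) (κ τ : Fin d), ‖covDerivFwd η U₀ κ (fun z => extd Ω₀ v z τ) y‖ ≤ η⁻¹ * (‖v‖ + ‖v‖) := fun y κ τ =>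
    (B9SupplySockB9P3ZdLettersOmega.norm_covDerivFwd_le hη (hU1 y κ) _).trans
      (mul_le_mul_of_nonneg_left (add_le_add (norm_extd_le Ω₀ v _ _) (norm_extd_le Ω₀ v _ _)) (inv_nonneg.mpr hη.le))
  have h0 : 0 ≤ 16 * d * η⁻¹ * η⁻¹ * ‖v‖ := by positivity
  refine (pi_norm_le_iff_of_nonneg h0).2 fun b => ?_
  calc ‖Kop Ω₀ η U₀ v b‖ = ‖Jcur η U₀ (extd Ω₀ v) b.1.2 b.1.1‖ := rfl
    _ ≤ 8 * d * (η⁻¹ * (η⁻¹ * (‖v‖ + ‖v‖))) := B9SupplySockB9P3Zd.norm_Jcur_le_of_grad hη hU1 hG _ _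
    _ = 16 * d * η⁻¹ * η⁻¹ * ‖v‖ := by ring

/-- `Φ_J` is a `½`-contraction for every unitary `U₀` and every `J`. [cite: Balaban1985BackgroundPropagators, (3.26)–(3.27) p.395] -/
theorem phi_contracting (hd : 1 ≤ d) {η : ℝ} (hη : 0 < η) {U₀ : Site d → Fin d → 𝔸ˣ} (hU₀ : ∀ x κ, U₀ x κ ∈ unitaryUnits 𝔸)
    (J : Site d → Fin d → 𝔸) : ContractingWith (1 / 2) (Phi Ω₀ η U₀ J) := by
  have hdpos : (0 : ℝ) < d := by exact_mod_cast hd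
  have ha : 0 < massA d η := by unfold massA; positivity
  have hhalf : ((1 / 2 : NNReal) : ℝ) = 1 / 2 := by norm_num
  refine ⟨by norm_num, LipschitzWith.of_dist_le_mul fun v w => ?_⟩
  rw [dist_eq_norm, dist_eq_norm, Phi, Phi, ← smul_sub, sub_sub_sub_cancel_left, norm_smul,
    Real.norm_of_nonneg (inv_nonneg.mpr ha.le), Kop_sub, norm_sub_rev v w, hhalf]
  calc (massA d η)⁻¹ * ‖Kop Ω₀ η U₀ (w - v)‖ ≤ (massA d η)⁻¹ * (16 * d * η⁻¹ * η⁻¹ * ‖w - v‖) :=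
        mul_le_mul_of_nonneg_left (norm_Kop_le Ω₀ hη hU₀ (w - v)) (inv_nonneg.mpr ha.le)
    _ = 1 / 2 * ‖w - v‖ := by unfold massA; field_simp; ring

end Ops

/-! ### The left inverse `G(U₀) = ext ∘ (𝟙(D*_{U₀}D_{U₀} + a)𝟙)⁻¹ ∘ restr` as a contraction fixed point, its bound, and the letters -/

section Gop

variable (Ω₀ : Set (Site d)) [Fintype (TB Ω₀)] [Nontrivial 𝔸]

/-- The fixed point of `Φ_J`: the unique `v` with `(K(U₀) + a)v = restr J` (Banach). [cite: Balaban1985BackgroundPropagators, (3.27) p.395] -/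
def fp (hd : 1 ≤ d) {η : ℝ} (hη : 0 < η) {U₀ : Site d → Fin d → 𝔸ˣ} (hU₀ : ∀ x κ, U₀ x κ ∈ unitaryUnits 𝔸)
    (J : Site d → Fin d → 𝔸) : TB Ω₀ → 𝔸 :=
  ContractingWith.fixedPoint (Phi Ω₀ η U₀ J) (phi_contracting Ω₀ hd hη hU₀ J)

/-- The fixed-point equation. [cite: Balaban1985BackgroundPropagators, (3.27) p.395] -/
theorem fp_eq (hd : 1 ≤ d) {η : ℝ} (hη : 0 < η) {U₀ : Site d → Fin d → 𝔸ˣ} (hU₀ : ∀ x κ, U₀ x κ ∈ unitaryUnits 𝔸)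
    (J : Site d → Fin d → 𝔸) : Phi Ω₀ η U₀ J (fp Ω₀ hd hη hU₀ J) = fp Ω₀ hd hη hU₀ J :=
  (phi_contracting Ω₀ hd hη hU₀ J).fixedPoint_isFixedPt

/-- Uniqueness of the fixed point. [cite: Balaban1985BackgroundPropagators, (3.27) p.395] -/
theorem fp_unique (hd : 1 ≤ d) {η : ℝ} (hη : 0 < η) {U₀ : Site d → Fin d → 𝔸ˣ} (hU₀ : ∀ x κ, U₀ x κ ∈ unitaryUnits 𝔸)
    (J : Site d → Fin d → 𝔸) {v : TB Ω₀ → 𝔸} (hv : Phi Ω₀ η U₀ J v = v) : v = fp Ω₀ hd hη hU₀ J :=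
  (phi_contracting Ω₀ hd hη hU₀ J).fixedPoint_unique hv

/-- **`‖(K + a)⁻¹ restr J‖ ≤ 2a⁻¹‖restr J‖`** (the a-priori bound of the fixed point). [cite: Balaban1985BackgroundPropagators, (3.47) p.398, (3.27) p.395] -/
theorem norm_fp_le (hd : 1 ≤ d) {η : ℝ} (hη : 0 < η) {U₀ : Site d → Fin d → 𝔸ˣ} (hU₀ : ∀ x κ, U₀ x κ ∈ unitaryUnits 𝔸)
    (J : Site d → Fin d → 𝔸) : ‖fp Ω₀ hd hη hU₀ J‖ ≤ 2 * (massA d η)⁻¹ * ‖restr Ω₀ J‖ := by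
  have hdpos : (0 : ℝ) < d := by exact_mod_cast hd
  have ha : 0 < massA d η := by unfold massA; positivity
  set v := fp Ω₀ hd hη hU₀ J with hv
  have h1 : v = (massA d η)⁻¹ • (restr Ω₀ J - Kop Ω₀ η U₀ v) := (fp_eq Ω₀ hd hη hU₀ J).symm
  have hK : ‖Kop Ω₀ η U₀ v‖ ≤ (massA d η) / 2 * ‖v‖ := by
    calc ‖Kop Ω₀ η U₀ v‖ ≤ 16 * d * η⁻¹ * η⁻¹ * ‖v‖ := norm_Kop_le Ω₀ hη hU₀ v
      _ = (massA d η) / 2 * ‖v‖ := by unfold massA; ring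
  have h2 : ‖v‖ ≤ (massA d η)⁻¹ * (‖restr Ω₀ J‖ + (massA d η) / 2 * ‖v‖) := by
    calc ‖v‖ = ‖(massA d η)⁻¹ • (restr Ω₀ J - Kop Ω₀ η U₀ v)‖ := by rw [← h1]
      _ = (massA d η)⁻¹ * ‖restr Ω₀ J - Kop Ω₀ η U₀ v‖ := by rw [norm_smul, Real.norm_of_nonneg (inv_nonneg.mpr ha.le)]
      _ ≤ (massA d η)⁻¹ * (‖restr Ω₀ J‖ + ‖Kop Ω₀ η U₀ v‖) := mul_le_mul_of_nonneg_left (norm_sub_le _ _) (inv_nonneg.mpr ha.le)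
      _ ≤ (massA d η)⁻¹ * (‖restr Ω₀ J‖ + (massA d η) / 2 * ‖v‖) := by gcongr
  have h3 : (massA d η)⁻¹ * ((massA d η) / 2 * ‖v‖) = ‖v‖ / 2 := by field_simp
  rw [mul_add, h3] at h2
  linarith

omit [Fintype (TB Ω₀)] [Nontrivial 𝔸] in
/-- If `J = D*_{U₀}D_{U₀}A + aA` on the Ω₀-bonds for a field `A` of E(Ω₀), then `restr A` is the fixed point of `Φ_J` (so `G(U₀)J = A`). [cite: Balaban1985BackgroundPropagators, (3.26)–(3.27) p.395] -/
theorem phi_restr_of_eq {η : ℝ} (hη : 0 < η) (hd : 1 ≤ d) (U₀ : Site d → Fin d → 𝔸ˣ) {A J : Site d → Fin d → 𝔸}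
    (hA : ∀ (y : Site d) (τ : Fin d), ¬ BondTouches Ω₀ y τ → A y τ = 0)
    (hJ : ∀ (y : Site d) (τ : Fin d), BondTouches Ω₀ y τ → J y τ = Jcur η U₀ A τ y + (massA d η : ℂ) • A y τ) :
    Phi Ω₀ η U₀ J (restr Ω₀ A) = restr Ω₀ A := by
  have hdpos : (0 : ℝ) < d := by exact_mod_cast hd
  have ha : 0 < massA d η := by unfold massA; positivity
  funext b
  have hK : Kop Ω₀ η U₀ (restr Ω₀ A) b = Jcur η U₀ A b.1.2 b.1.1 := by
    simp only [Kop, restr, extd_restr Ω₀ hA]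
  simp only [Phi, Pi.smul_apply, Pi.sub_apply, hK, restr, hJ b.1.1 b.1.2 b.2, add_sub_cancel_left, Complex.coe_smul, smul_smul,
    inv_mul_cancel₀ ha.ne', one_smul]

open Classical in
/-- **THE WITNESS LETTERS**: `G(U₀) := ext ∘ (K(U₀) + a)⁻¹ ∘ restr` for unitary `U₀` (else `0`), `Δ′ := 0`, `DRD* := 0`, `Q*aQ := a·1` — the trivial
massive regime, NOT [4]'s operators. [cite: Balaban1985BackgroundPropagators, (3.10) p.392, (3.16) p.393, (3.20)–(3.27) pp.394–395] -/
def opsW (hd : 1 ≤ d) (η : ℝ) (hη : 0 < η) : OpsZd d 𝔸 where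
  Gop := fun U₀ J => if hU₀ : ∀ x κ, U₀ x κ ∈ unitaryUnits 𝔸 then extd Ω₀ (fp Ω₀ hd hη hU₀ J) else 0
  Dp := fun _ _ _ _ => 0
  DRDs := fun _ _ _ _ => 0
  QQ := fun _ A x μ => (massA d η : ℂ) • A x μ

/-- `G(U₀)J = ext (fixed point)` at a unitary background. [cite: Balaban1985BackgroundPropagators, (3.27) p.395] -/
theorem opsW_Gop (hd : 1 ≤ d) {η : ℝ} (hη : 0 < η) {U₀ : Site d → Fin d → 𝔸ˣ} (hU₀ : ∀ x κ, U₀ x κ ∈ unitaryUnits 𝔸)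
    (J : Site d → Fin d → 𝔸) : (opsW Ω₀ hd η hη).Gop U₀ J = extd Ω₀ (fp Ω₀ hd hη hU₀ J) := by
  simp only [opsW, dif_pos hU₀]

/-- `‖(G(U₀)J)(b)‖ ≤ 2a⁻¹‖restr J‖`. [cite: Balaban1985BackgroundPropagators, (3.47) p.398] -/
theorem norm_opsW_Gop_le (hd : 1 ≤ d) {η : ℝ} (hη : 0 < η) {U₀ : Site d → Fin d → 𝔸ˣ} (hU₀ : ∀ x κ, U₀ x κ ∈ unitaryUnits 𝔸)
    (J : Site d → Fin d → 𝔸) (x : Site d) (μ : Fin d) :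
    ‖(opsW Ω₀ hd η hη).Gop U₀ J x μ‖ ≤ 2 * (massA d η)⁻¹ * ‖restr Ω₀ J‖ := by
  rw [opsW_Gop Ω₀ hd hη hU₀]
  exact (norm_extd_le Ω₀ _ x μ).trans (norm_fp_le Ω₀ hd hη hU₀ J)

/-- `G(U₀)J` vanishes off the Ω₀-bonds (Dirichlet). [cite: Balaban1985BackgroundPropagators, p.394, (3.27) p.395] -/
theorem opsW_Gop_of_not (hd : 1 ≤ d) {η : ℝ} (hη : 0 < η) {U₀ : Site d → Fin d → 𝔸ˣ} (hU₀ : ∀ x κ, U₀ x κ ∈ unitaryUnits 𝔸)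
    (J : Site d → Fin d → 𝔸) {x : Site d} {μ : Fin d} (h : ¬ BondTouches Ω₀ x μ) : (opsW Ω₀ hd η hη).Gop U₀ J x μ = 0 := by
  rw [opsW_Gop Ω₀ hd hη hU₀, extd_of_not Ω₀ h]

end Gop

/-! ### The frame (one member, local entries zero, (3.47)@−3 entries = the dictionary readings) and the binders at `(1, i, 0)` -/

section Frame

variable {𝔸₀ : Type} [CStarAlgebra 𝔸₀] [Nontrivial 𝔸₀]
variable {L : ℕ} (i : ZdIdx d L) [Fintype (TB (i.Ω 0))] (hd : 1 ≤ d)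

/-- The witness GEOMETRY: one coarse site, `η = i.η`, `M = 1`, arguments `Loc` = bond fields, `|·|₍₋₃₎ := bondNorm` at γ = −3 (else `0`), all other
readings `0`. [cite: Balaban1985BackgroundPropagators, (3.39)–(3.41) pp.396–397] -/
def geoW : B9.Geometry where
  Site := Unit
  scale := fun _ => 0
  dist := fun _ _ => 0
  k := 0
  eta := i.η
  L := L
  M := 1
  Loc := Site d → Fin d → 𝔸₀
  suppIn := fun _ _ => True
  suppInT := fun _ _ => True
  supNorm := fun _ => 0
  l2Norm := fun _ => 0
  wNorm := fun γ J => if γ = -3 then bondNorm L 0 i.η (-(3 : ℝ)) i.Ω J else 0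
  holder := fun _ _ => 0
  Cut := Unit
  cutIn := fun _ _ => True
  cutInT := fun _ _ => True
  cutH := fun _ _ => 0
  cutSup := fun _ => 0
  suppInT_of_suppIn := fun _ _ _ => trivial
  cutInT_of_cutIn := fun _ _ _ => trivial

/-- The witness BACKGROUNDS: configurations = unit-valued bond fields, every class `⊤`. [cite: Balaban1985BackgroundPropagators, (3.35)–(3.38) p.396] -/
def bgW (d : ℕ) (𝔸₀ : Type) [CStarAlgebra 𝔸₀] : B9.Backgrounds where
  Cfg := Site d → Fin d → 𝔸₀ˣ
  one := 1
  mul := fun U V => U * V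
  Reg335 := fun _ _ _ => True
  Reg336 := fun _ _ _ => True
  Cplx337 := fun _ _ _ => True
  Cplx338 := fun _ _ _ => True

/-- The (3.47)@−3 entries of the witness kernel family = the `DictAt` readings of `G(U₀)J` (n = 0, 1, 3; n = 2 unused, `0`). [cite: Balaban1985BackgroundPropagators, (3.47) p.398] -/
def globW (n : Fin 4) (U : Site d → Fin d → 𝔸₀ˣ) (J : Site d → Fin d → 𝔸₀) : ℝ :=
  if n = 0 then msup L 0 i.η (-(1 : ℝ)) (fun j (b : Site d × Fin d) => SideTouches (i.Ω j) b.1 b.2)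
      (fun b => (opsW (i.Ω 0) hd i.η i.hη).Gop U J b.1 b.2)
  else if n = 1 then msup L 0 i.η (-(2 : ℝ)) (fun j (t : Fin d × Fin d × Site d) => SideTouches (i.Ω j) t.2.2 t.2.1)
      (fun t => covDerivFwd i.η U t.1 (fun z => (opsW (i.Ω 0) hd i.η i.hη).Gop U J z t.2.1) t.2.2)
  else if n = 3 then bondNorm L 0 i.η (-(3 : ℝ)) i.Ω (fun x μ => covLap i.η U (fun z => (opsW (i.Ω 0) hd i.η i.hη).Gop U J z μ) x)
  else 0

/-- The witness KERNEL FAMILY for `G(U)`: local entries `0`, global entries `globW` at γ = −3. [cite: Balaban1985BackgroundPropagators, (3.42)–(3.47) pp.397–398] -/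
def GAW : B9.KernelFamily (geoW (𝔸₀ := 𝔸₀) i) (bgW d 𝔸₀) where
  e := fun _ _ _ _ => 0
  h1 := fun _ _ _ _ => 0
  e4 := fun _ _ _ => 0
  h2 := fun _ _ _ _ => 0
  l2 := fun _ _ _ _ => 0
  glob := fun n U J γ => if γ = -3 then globW i hd n U J else 0

omit [Nontrivial 𝔸₀] in
/-- `‖restr J‖ ≤ η⁻³|J|₍₋₃₎` at truncation `0` (the weight of `|·|₍₋₃₎` at level 0 is `η³`). [cite: Balaban1985RegularSpaces, p.86 (definition after (1.55))] -/
theorem norm_restr_le_of_bondNorm {η : ℝ} (hη : 0 < η) (hηi : i.η = η) (J : Site d → Fin d → 𝔸₀) :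
    ‖restr (i.Ω 0) J‖ ≤ (η ^ 3)⁻¹ * bondNorm L 0 i.η (-(3 : ℝ)) i.Ω J := by
  subst hηi
  have e3 : (-(3 : ℝ)) = -((3 : ℕ) : ℝ) := by norm_num
  have hw : weight L i.η (-(3 : ℝ)) 0 = i.η ^ 3 := by rw [e3, B8ScaledSupNorm.weight_neg_natCast, pow_zero, one_mul]
  have hη3 : 0 < i.η ^ 3 := by positivity
  have hBdd : Bdd L 0 i.η (-(3 : ℝ)) (fun j (b : Site d × Fin d) => BondTouches (i.Ω j) b.1 b.2) (fun b => J b.1 b.2) := by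
    refine ⟨weight L i.η (-(3 : ℝ)) 0 * ‖restr (i.Ω 0) J‖, fun j hj b hb => ?_⟩
    obtain rfl : j = 0 := Nat.le_zero.mp hj
    exact mul_le_mul_of_nonneg_left (norm_le_pi_norm (restr (i.Ω 0) J) ⟨b, hb⟩) (by rw [hw]; exact hη3.le)
  have hW0 : 0 ≤ bondNorm L 0 i.η (-(3 : ℝ)) i.Ω J := B8ScaledSupNorm.msup_nonneg L 0 hη.le _ _ _
  refine (pi_norm_le_iff_of_nonneg (by positivity)).2 fun b => ?_
  have h := B8ScaledSupNorm.weight_mul_norm_le_msup hBdd (le_refl 0) (i := b.1) b.2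
  rw [hw] at h
  rw [le_inv_mul_iff₀ hη3]
  exact h

/-- **(3.47) AT γ = −3 FOR THE WITNESS `G(U₀)`, `B₀ = 1`**: `|G J|₍₋₁₎, |∇_{U₀}G J|₍₋₂₎, |Δ_{U₀}G J|₍₋₃₎ ≤ |J|₍₋₃₎` at truncation `0` — from
`‖G J‖ ≤ 2a⁻¹η⁻³|J|₍₋₃₎`, `norm_covDerivFwd_le`, `norm_covLap_le`, and `aη² = 32d`. [cite: Balaban1985BackgroundPropagators, (3.47) p.398, Thm 3.3 p.399] -/
theorem glob_bounds {η : ℝ} (hη : 0 < η) (hηi : i.η = η) {U : Site d → Fin d → 𝔸₀ˣ} (hU : ∀ x κ, U x κ ∈ unitaryUnits 𝔸₀)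
    (J : Site d → Fin d → 𝔸₀) (n : Fin 4) : globW i hd n U J ≤ bondNorm L 0 i.η (-(3 : ℝ)) i.Ω J := by
  have hdpos : (0 : ℝ) < d := by exact_mod_cast hd
  have hd1 : (1 : ℝ) ≤ d := by exact_mod_cast hd
  have hηi' := hηi
  subst hηi
  set W := bondNorm L 0 i.η (-(3 : ℝ)) i.Ω J with hW
  have hW0 : 0 ≤ W := B8ScaledSupNorm.msup_nonneg L 0 hη.le _ _ _
  have ha : 0 < massA d i.η := by unfold massA; positivity
  have hU1 : ∀ y κ, U y κ ∈ U1 𝔸₀ := fun y κ => unitaryUnits_le_U1 (hU y κ)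
  -- the uniform pointwise bound on G(U)J
  have hG : ∀ (x : Site d) (μ : Fin d), ‖(opsW (i.Ω 0) hd i.η i.hη).Gop U J x μ‖ ≤ 2 * (massA d i.η)⁻¹ * ((i.η ^ 3)⁻¹ * W) :=
    fun x μ => (norm_opsW_Gop_le (i.Ω 0) hd i.hη hU J x μ).trans
      (mul_le_mul_of_nonneg_left (norm_restr_le_of_bondNorm i hη rfl J) (by positivity))
  have hkey : 2 * (massA d i.η)⁻¹ * ((i.η ^ 3)⁻¹ * W) = W / (16 * d * i.η) := by
    unfold massA; field_simp; ring
  rw [hkey] at hG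
  have e1 : (-(1 : ℝ)) = -((1 : ℕ) : ℝ) := by norm_num
  have e2 : (-(2 : ℝ)) = -((2 : ℕ) : ℝ) := by norm_num
  have e3 : (-(3 : ℝ)) = -((3 : ℕ) : ℝ) := by norm_num
  unfold globW
  split_ifs with h0 h1 h3
  · -- n = 0: |G J|₍₋₁₎ ≤ W
    refine B8ScaledSupNorm.msup_le hW0 fun j hj b _ => ?_
    obtain rfl : j = 0 := Nat.le_zero.mp hj
    rw [e1, B8ScaledSupNorm.weight_neg_natCast, pow_zero, one_mul, pow_one]
    calc i.η * ‖(opsW (i.Ω 0) hd i.η i.hη).Gop U J b.1 b.2‖ ≤ i.η * (W / (16 * d * i.η)) := mul_le_mul_of_nonneg_left (hG _ _) hη.le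
      _ = W / (16 * d) := by field_simp
      _ ≤ W := by rw [div_le_iff₀ (by positivity)]; nlinarith
  · -- n = 1: |∇ G J|₍₋₂₎ ≤ W
    refine B8ScaledSupNorm.msup_le hW0 fun j hj t _ => ?_
    obtain rfl : j = 0 := Nat.le_zero.mp hj
    rw [e2, B8ScaledSupNorm.weight_neg_natCast, pow_zero, one_mul]
    have hgrad : ‖covDerivFwd i.η U t.1 (fun z => (opsW (i.Ω 0) hd i.η i.hη).Gop U J z t.2.1) t.2.2‖ ≤
        i.η⁻¹ * (W / (16 * d * i.η) + W / (16 * d * i.η)) :=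
      (B9SupplySockB9P3ZdLettersOmega.norm_covDerivFwd_le hη (hU1 _ _) _).trans
        (mul_le_mul_of_nonneg_left (add_le_add (hG _ _) (hG _ _)) (inv_nonneg.mpr hη.le))
    calc i.η ^ 2 * ‖covDerivFwd i.η U t.1 (fun z => (opsW (i.Ω 0) hd i.η i.hη).Gop U J z t.2.1) t.2.2‖
        ≤ i.η ^ 2 * (i.η⁻¹ * (W / (16 * d * i.η) + W / (16 * d * i.η))) := mul_le_mul_of_nonneg_left hgrad (by positivity)
      _ = W / (8 * d) := by field_simp; ring
      _ ≤ W := by rw [div_le_iff₀ (by positivity)]; nlinarith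
  · -- n = 3: |Δ G J|₍₋₃₎ ≤ W
    refine B8ScaledSupNorm.msup_le hW0 fun j hj b _ => ?_
    obtain rfl : j = 0 := Nat.le_zero.mp hj
    rw [e3, B8ScaledSupNorm.weight_neg_natCast, pow_zero, one_mul]
    have hlap := B9SupplySockB9P3ZdLettersOmega.norm_covLap_le hη hU1 (f := fun z => (opsW (i.Ω 0) hd i.η i.hη).Gop U J z b.2)
      (fun y => hG y b.2) b.1
    calc i.η ^ 3 * ‖covLap i.η U (fun z => (opsW (i.Ω 0) hd i.η i.hη).Gop U J z b.2) b.1‖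
        ≤ i.η ^ 3 * (4 * d * (i.η⁻¹ * (i.η⁻¹ * (W / (16 * d * i.η))))) := mul_le_mul_of_nonneg_left hlap (by positivity)
      _ = W / 4 := by field_simp; ring
      _ ≤ W := by linarith
  · exact hW0

end Frame

/-! ### The witness at the cube member of (1.131), truncation `m = 0` -/

section Main

variable {𝔸₀ : Type} [CStarAlgebra 𝔸₀] [Nontrivial 𝔸₀]
variable {L : ℕ}

/-- At truncation `0` every INNER bond of `□₀` is a constraint bond of the cube member (`cubeLamB … 0 0`: box `{c₋, c₊} ⊂ □₀`, both end-points in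
`cubeLamS … 0 0 = □₀`). [cite: Balaban1985RegularSpaces, (1.31) p.82, (1.68) p.88, (1.131) p.99] -/
theorem cube_inner_mem_lamB0 {a : Site d} {M ρ k : ℕ} {z : Site d} {κ : Fin d}
    (hz : z ∈ cube L a M ρ k 0) (hz' : z + e κ ∈ cube L a M ρ k 0) : (z, κ) ∈ cubeLamB L a M ρ k 0 0 := by
  simp only [cube, Set.mem_setOf_eq, B8Ineq130.tlo_zero, B8Ineq130.thi_zero] at hz hz'
  refine ⟨fun x hx => ?_, Or.inl ⟨by rw [cubeLamS_self]; exact hz, by rw [cubeLamS_self]; exact hz'⟩⟩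
  rw [cubeFam_false_zero]
  simp only [cube, Set.mem_setOf_eq, B8Ineq130.tlo_zero, B8Ineq130.thi_zero]
  intro n
  have h1 := (hx n).1
  have h2 := (hx n).2
  simp only [loK, bondHiK, pow_zero, one_mul, sub_self, add_zero] at h1 h2
  have hz1 := hz n
  have hz2 := hz' n
  simp only [Pi.add_apply, B7Prop1Explicit.e_apply] at hz2
  by_cases hn : n = κ
  · rw [if_pos hn] at h2 hz2; exact ⟨by linarith [hz1.1], by linarith [hz2.2]⟩
  · rw [if_neg hn] at h2 hz2; exact ⟨by linarith [hz1.1], by linarith [hz1.2]⟩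

/-- ★★ **A6 WITNESS: THE HYPOTHESIS SET OF `sockB9P3D4β_at` IS INHABITED AT EVERY CUBE MEMBER OF (1.131) AND TRUNCATION `m = 0`** (`d ≥ 2`, `L ≥ 1`,
`ρ ≥ 2`; any C⋆-algebra `𝔸₀ : Type`): there are a frame, member maps, letters and constants (`M = 1`, `K₆ = c₆ = a₃ = a₀ = B₀ = 1`, `c₆₉ = 0`,
`q = aη²`) with `DictAt ∧ Prop6At ∧ InvAt ∧ CurvAt ∧ LandauAt ∧ AvgAtβ` at `(1, i, 0)`, `Margin2`, and Theorem 3.3's (3.42)∕(3.46)∕(3.47) block for every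
unitary `U₀` — the witness letters `Witness.opsW` (trivial massive regime) and frame `geoW ∕ bgW ∕ GAW`. [cite: Balaban1985BackgroundPropagators, Thm 3.3 p.399, (3.26)–(3.27) p.395, (3.47) p.398, (3.16) p.393; Balaban1985RegularSpaces, (1.58)–(1.59) p.86, (1.131) p.99, p.77] -/
theorem binders_inhabited_cube_zero (hd2 : 2 ≤ d) (hL : 1 ≤ L) (i : ZdIdx d L) {a : Site d} {Mc ρ : ℕ} (hρ : 2 ≤ ρ)
    (hΩ : i.Ω = cubeFam false L a Mc ρ i.k) (hΛb : i.Λb = cubeLamB L a Mc ρ i.k) :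
    ∃ (I : Type) (geo : I → B9.Geometry) (bg : I → B9.Backgrounds) (GA : ∀ x, B9.KernelFamily (geo x) (bg x))
      (mem : ℝ → ZdIdx d L → ℕ → I)
      (ιCfg : ∀ (M : ℝ) (i' : ZdIdx d L) (m : ℕ) (U₀ : Site d → Fin d → 𝔸₀ˣ), (∀ x κ, U₀ x κ ∈ unitaryUnits 𝔸₀) → (bg (mem M i' m)).Cfg)
      (ιLoc : ∀ (M : ℝ) (i' : ZdIdx d L) (m : ℕ), (Site d → Fin d → 𝔸₀) → (geo (mem M i' m)).Loc)
      (ops : ℝ → ZdIdx d L → ℕ → OpsZd d 𝔸₀) (c35 c₆ K₆ a₃ c69 q B₀ δ₀ a₀ : ℝ),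
      0 < K₆ ∧ 0 ≤ c69 ∧ 0 ≤ q ∧ 0 < B₀ ∧ 0 < c₆ ∧ 0 < a₃ ∧ 0 < a₀ ∧ Margin2 i.Ω ∧ 0 ≤ i.k ∧
      DictAt geo bg GA L mem ιCfg ιLoc ops 1 i 0 ∧ Prop6At bg L mem ιCfg c35 c₆ K₆ 1 i 0 ∧ InvAt bg L mem ιCfg ops c35 a₃ 1 i 0 ∧
      CurvAt bg L mem ιCfg ops c35 a₃ c69 1 i 0 ∧ LandauAt bg L mem ιCfg ops c35 a₃ 1 i 0 ∧ AvgAtβ L ops q 1 i 0 ∧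
      (∀ (α₀ : ℝ) (U₀ : Site d → Fin d → 𝔸₀ˣ) (hU₀ : ∀ x κ, U₀ x κ ∈ unitaryUnits 𝔸₀), 0 < α₀ → 1 * α₀ ≤ a₀ →
        (bg (mem 1 i 0)).Reg335 c35 α₀ (ιCfg 1 i 0 U₀ hU₀) → B9.Ineq342_346_347 (GA (mem 1 i 0)) B₀ δ₀ (ιCfg 1 i 0 U₀ hU₀)) := by
  classical
  have hd : 1 ≤ d := le_trans one_le_two hd2
  have hη : 0 < i.η := i.hη
  have hdpos : (0 : ℝ) < d := by exact_mod_cast hd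
  have ha : 0 < massA d i.η := by unfold massA; positivity
  have hΩ0 : i.Ω 0 = {x | InBox (sqLo L a ρ i.k 0) (sqHi L a Mc ρ i.k 0) x} := by
    rw [hΩ, cubeFam_false_zero]; ext x; simp [cube]
  haveI : Fintype (TB (i.Ω 0)) := by
    have hfin := finite_TB_of_box (d := d) (sqLo L a ρ i.k 0) (sqHi L a Mc ρ i.k 0)
    rw [← hΩ0] at hfin
    exact hfin.fintype
  refine ⟨Unit, fun _ => geoW i, fun _ => bgW d 𝔸₀, fun _ => GAW i hd, fun _ _ _ => (), fun _ _ _ U₀ _ => U₀, fun _ _ _ J => J,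
    fun _ _ _ => opsW (i.Ω 0) hd i.η i.hη, 0, 1, 1, 1, 0, massA d i.η * i.η ^ 2, 1, 0, 1,
    one_pos, le_rfl, by positivity, one_pos, one_pos, one_pos, one_pos, ?_, Nat.zero_le _, ?_, ?_, ?_, ?_, ?_, ?_, ?_⟩
  · rw [hΩ]; exact B9SupplySockB9P3ZdLettersOmega.margin2_cubeFam L a Mc hρ i.k
  · -- the norm dictionary: by construction of the frame
    refine ⟨rfl, fun U₀ hU₀ J => ⟨?_, ?_, ?_, ?_⟩⟩
    · simp [geoW]
    · simp [GAW, globW]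
    · simp [GAW, globW]
    · simp [GAW, globW]
  · -- Proposition 6's class: `Reg335 := ⊤`
    intro _ _ _ _ _ _; trivial
  · -- (3.27): G(U₀) is a left inverse of Δ_a(U₀) = D*_{U₀}D_{U₀} + a on E(Ω₀)
    intro α₀ U₀ hU₀ _ _ _ A hA J hJ
    have hJ' : ∀ (y : Site d) (τ : Fin d), BondTouches (i.Ω 0) y τ →
        J y τ = Jcur i.η U₀ A τ y + (massA d i.η : ℂ) • A y τ := by
      intro y τ hb
      rw [hJ y τ hb]
      simp [deltaAOf, opsW]
    have hfix := fp_unique (i.Ω 0) hd hη hU₀ J (phi_restr_of_eq (i.Ω 0) hη hd U₀ hA.1 hJ')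
    show (opsW (i.Ω 0) hd i.η i.hη).Gop U₀ J = A
    rw [opsW_Gop (i.Ω 0) hd hη hU₀, ← hfix, extd_restr (i.Ω 0) hA.1]
  · -- (3.69): `Δ′ := 0`
    intro α₀ U₀ hU₀ hα₀ _ _ A _ j _ x μ _
    show ((L : ℝ) ^ j * i.η) ^ 3 * ‖(0 : 𝔸₀)‖ ≤ 0 * 1 * α₀ * _
    simp
  · -- the Landau letter: `DRD* := 0`
    intro _ _ _ _ _ _ _ _ _ _ _; rfl
  · -- (3.16) in the β currency: `Q*aQ := a·1`, `q := aη²`; every Ω₀-bond is a level-0 constraint bond or a crossing bond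
    intro U₀ hU₀ A hA j hj x μ hb
    obtain rfl : j = 0 := Nat.le_zero.mp hj
    show ((L : ℝ) ^ 0 * i.η) ^ 3 * ‖(massA d i.η : ℂ) • A x μ‖ ≤ _
    obtain ⟨c, hc⟩ := hA.2
    have e1 : (-(1 : ℝ)) = -((1 : ℕ) : ℝ) := by norm_num
    have hw1 : weight L i.η (-(1 : ℝ)) 0 = i.η := by rw [e1, B8ScaledSupNorm.weight_neg_natCast, pow_zero, one_mul, pow_one]
    have hside : ∀ (y : Site d) (τ : Fin d), BondTouches (i.Ω 0) y τ → SideTouches (i.Ω 0) y τ := fun y τ h => by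
      obtain ⟨κ, hκ⟩ := B9SupplySockB9P3ZdSocketBoundaryMode.exists_ne_fin hd2 τ
      exact B8Eq140Level.sideTouches_of_bondTouches hκ h
    have hnormA : ∀ (y : Site d) (τ : Fin d), BondTouches (i.Ω 0) y τ → i.η * ‖A y τ‖ ≤ c := fun y τ h => by
      have := hc 0 le_rfl (y, τ) (hside y τ h); rwa [hw1] at this
    have hbd : ∀ p : {p : ℕ × (Site d × Fin d) // p.1 ≤ 0 ∧ (p.2 ∈ i.Λb 0 p.1 ∨ (p.1 = 0 ∧ CrossB (i.Ω 0) p.2))},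
        1 * ‖linCovIter L U₀ (iEta i.η A) p.1.1 p.1.2.1 p.1.2.2‖ ≤ c := by
      rintro ⟨⟨j', b⟩, hj', hb'⟩
      obtain rfl : j' = 0 := Nat.le_zero.mp hj'
      have hbt : BondTouches (i.Ω 0) b.1 b.2 := by
        rcases hb' with hmem | ⟨-, hcr⟩
        · exact Or.inl (i.hbox 0 (Nat.zero_le _) 0 le_rfl b hmem b.1 (by simpa using B8CubeMemberZd.smul_mem_bondBox hL 0 b.1 b.2))
        · exact hcr.1
      dsimp only
      rw [one_mul, B7Prop4GeneralLevels.linCovIter_zero, iEta, norm_smul, norm_mul, Complex.norm_I, one_mul, Complex.norm_real,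
        Real.norm_of_nonneg hη.le]
      exact hnormA b.1 b.2 hbt
    have hidx : (x, μ) ∈ i.Λb 0 0 ∨ ((0 : ℕ) = 0 ∧ CrossB (i.Ω 0) (x, μ)) := by
      by_cases hin : x ∈ i.Ω 0 ∧ x + e μ ∈ i.Ω 0
      · left
        have hx1 : x ∈ cube L a Mc ρ i.k 0 := by have h := hin.1; rw [hΩ, cubeFam_false_zero] at h; exact h
        have hx2 : x + e μ ∈ cube L a Mc ρ i.k 0 := by have h := hin.2; rw [hΩ, cubeFam_false_zero] at h; exact h
        rw [hΛb]; exact cube_inner_mem_lamB0 hx1 hx2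
      · right; exact ⟨rfl, hb, hin⟩
    have hle := B8Eq155JBound.le_wsup hbd ⟨(0, (x, μ)), le_rfl, hidx⟩
    dsimp only at hle
    rw [one_mul, B7Prop4GeneralLevels.linCovIter_zero, iEta, norm_smul, norm_mul, Complex.norm_I, one_mul, Complex.norm_real,
      Real.norm_of_nonneg hη.le] at hle
    rw [pow_zero, one_mul, norm_smul, Complex.norm_real, Real.norm_of_nonneg ha.le]
    calc i.η ^ 3 * (massA d i.η * ‖A x μ‖) = (massA d i.η * i.η ^ 2) * (i.η * ‖A x μ‖) := by ring
      _ ≤ (massA d i.η * i.η ^ 2) * _ := mul_le_mul_of_nonneg_left hle (by positivity)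
  · -- Theorem 3.3's (3.42)∕(3.46)∕(3.47) block for G(U₀): local entries vanish, the γ = −3 globals by `glob_bounds`
    intro α₀ U₀ hU₀ _ _ _
    refine ⟨fun n lam y y' _ => by simp [GAW, geoW], fun n lam h y y' _ _ => by simp [GAW, geoW], fun n lam γ _ _ => ?_⟩
    show (GAW i hd).glob n U₀ lam γ ≤ 1 * (geoW i).wNorm γ lam
    by_cases hγ : γ = -3
    · subst hγ; simp only [GAW, geoW, if_true, one_mul]; exact glob_bounds i hd hη rfl hU₀ lam n
    · simp [GAW, geoW, hγ]

/-- ★ **HENCE THE β COLLAR SOCKET HOLDS AT EVERY CUBE MEMBER AT TRUNCATION `0`** for some `B₀ > 0`, `B_∂ ≥ 0`, `cP > 0` — `sockB9P3D4β_at` applied to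
the A6 witness: the member supplier is NOT vacuous there (contrast `B9SupplySockB9P3ZdSocketBoundaryMode.not_sockB9P3D4_cube` for the old currency).
[cite: Balaban1985RegularSpaces, (1.59) p.86, (1.131) p.99; Balaban1985BackgroundPropagators, Thm 3.3 p.399] -/
theorem sockB9P3D4β_at_nonvacuous_cube_zero (hd2 : 2 ≤ d) (hL : 1 ≤ L) (i : ZdIdx d L) {a : Site d} {Mc ρ : ℕ} (hρ : 2 ≤ ρ)
    (hΩ : i.Ω = cubeFam false L a Mc ρ i.k) (hΛb : i.Λb = cubeLamB L a Mc ρ i.k) :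
    ∃ B₀ Bbd cP : ℝ, 0 < B₀ ∧ 0 ≤ Bbd ∧ 0 < cP ∧ SockB9P3D4β (𝔸 := 𝔸₀) L B₀ Bbd cP i.η 0 i.Ω i.Λs i.Λb := by
  obtain ⟨I, geo, bg, GA, mem, ιCfg, ιLoc, ops, c35, c₆, K₆, a₃, c69, q, B₀, δ₀, a₀, hK₆, hc69, hq, hB₀, hc₆, ha₃, ha₀, hMi, hk, hdict, hP6,
    hinv, hcurv, hlan, havg, h33U⟩ := binders_inhabited_cube_zero (𝔸₀ := 𝔸₀) hd2 hL i hρ hΩ hΛb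
  refine ⟨_, _, _, ?_, ?_, ?_, sockB9P3D4β_at geo bg GA L mem ιCfg ιLoc ops hd2 hL le_rfl i hMi hk hdict hP6 hinv hcurv hlan havg hK₆ hc69 hq
    (δ₀ := δ₀) hB₀ h33U⟩
  · positivity
  · positivity
  · have h1 : 0 < 2 * B₀ * c69 * K₆ * 1 + 1 := by positivity
    simp only [lt_min_iff]
    exact ⟨by norm_num, by positivity, by positivity, by positivity, by positivity⟩

end Main

end Witness

end Literature.MathematicalPhysics.QuantumFieldTheory.Balaban1983to89.B9SupplySockB9P3ZdBeta

end
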